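import Literature.NumberTheory.LFunctions.LargeValuesFullBoundFreeT
import Literature.NumberTheory.LFunctions.GuthMaynardS2BoundAsPrinted
import Literature.NumberTheory.LFunctions.GuthMaynardS3BoundAsPrinted
import Literature.NumberTheory.LFunctions.GuthMaynardEnergyBoundAsPrinted
import Literature.NumberTheory.LFunctions.LargeValuesGuthMaynardReduction
import Literature.NumberTheory.LFunctions.GuthMaynardLargeValuesTheorem
import Literature.NumberTheory.LFunctions.LargeValuesLongPolynomials
import Literature.NumberTheory.LFunctions.LargeValuesJutilaHolds
import HarnessLib

/-!
# Guth–Maynard Proposition 12.1 (large values for `N ≥ T^{5/6}`): eq. (12.1) wired with `T` and `k` free, the reduction of §3, and the assembly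

LABEL (line 1 of every C4 file): **NOT RH-BEARING** — large-values estimates bound how often a
Dirichlet polynomial is large; the density theorems they feed COUNT zeros off the critical line and
never empty the strip (`Literature.Barriers.RiemannHypothesis.LindelofBacklund`). Corpus theorems
are RH-FREE literature; nothing in this file bears on the truth of RH.

Topic `NumberTheory/LFunctions`; corpus C4 = Guth–Maynard, *New large value estimates for Dirichlet
polynomials*, Ann. of Math. (2) 203 (2026) = arXiv:2405.20552, §12: eq. (12.1) and Proposition 12.1
(arXiv chunk p0026:L5–L25, L44–L90, p0027), Proposition 11.2 (p0022:L36), with the reduction of §3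
(p0008). Everything in this file is PROVED; no definition and no named fact is introduced. The
statements being proved are the tree's `GuthMaynard2026_proposition_12_1_inf_on (7/10)` (first display
of Proposition 12.1) and `GuthMaynard2026_proposition_12_1` (`LargeValuesLongPolynomials.lean`).

## Contents (in the order of the printed argument)

* `GuthMaynardFullBound.S3_numeric_freeT` — Proposition 11.2 with `T` free: substituting Prop. 11.1
  (`E(W) ⪅ |W|N^{4−4σ} + |W|^{21/8}T^{1/4}N^{1−2σ} + |W|³N^{1−2σ}`) into Prop. 10.1
  (`S₃ ⪅ T²|W|^{3/2} + TN|W|^{1/2}E(W)^{1/2}`):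
  `S₃ ⪅ T²|W|^{3/2} + T|W|N^{3−2σ} + T|W|²N^{3/2−σ} + T^{9/8}|W|^{29/16}N^{3/2−σ}`.
* `GuthMaynardFullBound.card_le_freeT_setting` — Propositions 4.6 and 5.1 packaged for `W` in an
  interval of length `T`, `T^ε`-separated, `N ≤ T ≤ N²`, with the constant UNIFORM in `σ` (the tree's
  `GuthMaynardFourier.card_le_keyProp_setting` is the case `T = N^{6/5}` with `σ` bound first).
* `GuthMaynardFullBound.fullBound_keyProp_setting` — eq. (12.1) in the key-proposition setting with
  `T` and `k` free: `card_le_freeT_setting` + Proposition 6.1 as printed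
  (`GuthMaynard2026_proposition_6_1`, `GuthMaynardS2BoundAsPrinted.lean`) + Proposition 10.1 as printed
  (`GuthMaynard2026_proposition_10_1`, `GuthMaynardS3BoundAsPrinted.lean`) + Proposition 11.1 as printed
  (its statement `h111` = `GuthMaynard2026_proposition_11_1`, `GuthMaynardEnergyBoundAsPrinted.lean`)
  through `S3_numeric_freeT`, and the rearrangement `GuthMaynardAssemblyFreeT.fullBound_of_bounds`
  (`LargeValuesFullBoundFreeT.lean`, the pure real-inequality layer of (12.1)).
* `GuthMaynardFullBound.largeValues_of_fullBound` — (12.1) for unweighted Dirichlet polynomials on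
  `1`-separated `W ⊂ [0,T]`, `T^{5/6} ≤ N ≤ T` (the reduction of §3: three pieces, weight insertion,
  thinning; `GuthMaynardReduction`).
* `GuthMaynardFullBound.inf_bound_fixed_k` — "the bound now follows from (12.1), (1.1) and a little
  algebra": the four-term first display of Proposition 12.1 for each fixed `k` (mean value theorem
  `GuthMaynardLargeValues.largeValues_mvt_logFree` for the term `min(TN^{1−2σ}, N^{5−6σ})`).
* `GuthMaynardFullBound.inf_on_of_forall_k` — the constant made uniform in `k` (the `inf_k`).
* `GuthMaynard2026_proposition_12_1_inf_of_props` — the first display for ALL `σ ≥ 7/10` from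
  Propositions 6.1, 10.1 (by name) and the statement of 11.1; no use of Jutila's theorem.
* `GuthMaynard2026_proposition_12_1_of_props_of_jutila` — both displays, the second one via
  `GuthMaynard2026_proposition_12_1_of_inf_of_jutila` (`LargeValuesLongPolynomials.lean`) from Jutila's
  large values theorem (`Jutila1977_largeValues`, proved from the named fact `Jutila1977_theorem_1_4`).
* `GuthMaynard2026_proposition_12_1_inf_holds` — the first display UNCONDITIONALLY (feeding the tree's
  `GuthMaynard2026_proposition_6_1_holds`, `_10_1_holds`, `_11_1_holds`);
  `GuthMaynard2026_proposition_12_1_of_jutilaLargeValues`, `GuthMaynard2026_proposition_12_1_of_jutila` —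
  Proposition 12.1 modulo `Jutila1977_largeValues`, resp. the named fact `Jutila1977_theorem_1_4`.
* `GuthMaynard2026_proposition_12_1_holds` — Proposition 12.1 (both displays) UNCONDITIONALLY: Jutila's
  theorem is the tree's `Jutila1977_largeValues_holds` / `Jutila1977_theorem_1_4_holds`
  (`LargeValuesJutilaHolds.lean`, proved along Jutila 1977 §§2–3), so the named statement
  `GuthMaynard2026_proposition_12_1` is discharged.

Proposition 11.1 enters as the hypothesis `h111` (its statement verbatim) rather than by the name of
the tree's theorem `GuthMaynard2026_proposition_11_1_holds`, so that this file does not import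
`GuthMaynardEnergyBoundAsPrinted`; feeding `GuthMaynard2026_proposition_6_1_holds`,
`GuthMaynard2026_proposition_10_1_holds`, `GuthMaynard2026_proposition_11_1_holds` gives the first
display unconditionally (`GuthMaynard2026_proposition_12_1_inf_holds`) and Proposition 12.1 modulo
`Jutila1977_theorem_1_4` (`GuthMaynard2026_proposition_12_1_of_jutila`).

## References
* L. Guth, J. Maynard, *New large value estimates for Dirichlet polynomials*, Ann. of Math. (2) 203
  (2026) 623–675; arXiv:2405.20552; §3, §12 (eq. (12.1), Proposition 12.1), Propositions 4.6, 5.1,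
  6.1, 10.1, 11.1, 11.2, eq. (1.1). [`GuthMaynard2026`]
* M. Jutila, *Zero-density estimates for L-functions*, Acta Arith. 32 (1977) 55–62, Theorem (1.4).
  [`Jutila1977`]
-/

noncomputable section

open Real Set Filter Topology Complex MeasureTheory Finset
open scoped ContDiff

namespace Literature.NumberTheory.LFunctions

namespace GuthMaynardFullBound

open GuthMaynardAssembly GuthMaynardFourier

/-! ## Proposition 11.2 with `T` free -/

set_option maxHeartbeats 1000000 in
/-- **Proposition 11.2 (`S₃` bound), numerically, with `T` free**: if `n, T, L ≥ 1`, `X, E ≥ 0`,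
`S₃ ≤ C₃ L (T²X^{3/2} + TnX^{1/2}E^{1/2})` (Proposition 10.1) and
`E ≤ C₄ L (Xn^{4−4σ} + X^{21/8}T^{1/4}n^{1−2σ} + X³n^{1−2σ})` (Proposition 11.1), then
`S₃ ≤ C₃(1 + C₄^{1/2}) L² (T²X^{3/2} + TXn^{3−2σ} + TX²n^{3/2−σ} + T^{9/8}X^{29/16}n^{3/2−σ})` — "An
immediate consequence of Proposition 11.1 is a good bound for the key term `S₃` by substituting the
bound of Proposition 11.1 into Proposition 10.1" (`E^{1/2} ≤ ∑ u_i^{1/2}`).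
[cite: GuthMaynard2026, Proposition 11.2] -/
theorem S3_numeric_freeT {C₃ C₄ n T L σ X E S₃ : ℝ} (hC₃ : 0 ≤ C₃) (hC₄ : 0 ≤ C₄)
    (hn : 1 ≤ n) (hT : 1 ≤ T) (hL : 1 ≤ L) (hX : 0 ≤ X) (hE : 0 ≤ E)
    (hS₃ : S₃ ≤ C₃ * L * (T ^ 2 * X ^ (3 / 2 : ℝ) + T * n * X ^ (1 / 2 : ℝ) * E ^ (1 / 2 : ℝ)))
    (hEn : E ≤ C₄ * L * (X * n ^ (4 - 4 * σ) + X ^ (21 / 8 : ℝ) * T ^ (1 / 4 : ℝ) * n ^ (1 - 2 * σ) +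
      X ^ 3 * n ^ (1 - 2 * σ))) :
    S₃ ≤ C₃ * (1 + C₄ ^ (1 / 2 : ℝ)) * L ^ 2 * (T ^ 2 * X ^ (3 / 2 : ℝ) + T * X * n ^ (3 - 2 * σ) +
      T * X ^ 2 * n ^ (3 / 2 - σ) + T ^ (9 / 8 : ℝ) * X ^ (29 / 16 : ℝ) * n ^ (3 / 2 - σ)) := by
  have hn0 : 0 < n := by linarith
  have hT0 : 0 < T := by linarith
  have hL0 : 0 ≤ L := by linarith
  -- names for the four terms
  set t₄ : ℝ := T ^ 2 * X ^ (3 / 2 : ℝ) with ht₄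
  set t₅ : ℝ := T * X * n ^ (3 - 2 * σ) with ht₅
  set t₆ : ℝ := T * X ^ 2 * n ^ (3 / 2 - σ) with ht₆
  set t₇ : ℝ := T ^ (9 / 8 : ℝ) * X ^ (29 / 16 : ℝ) * n ^ (3 / 2 - σ) with ht₇
  have h₄ : 0 ≤ t₄ := by positivity
  have h₅ : 0 ≤ t₅ := by positivity
  have h₆ : 0 ≤ t₆ := by positivity
  have h₇ : 0 ≤ t₇ := by positivity
  -- `L ≤ L²`, `L · L^{1/2} ≤ L²`
  have hL2 : L ≤ L ^ 2 := by nlinarith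
  have hL12 : L * L ^ (1 / 2 : ℝ) ≤ L ^ 2 := by
    have : L ^ (1 / 2 : ℝ) ≤ L ^ (1 : ℝ) := Real.rpow_le_rpow_of_exponent_le hL (by norm_num)
    rw [Real.rpow_one] at this
    nlinarith
  -- the energy substitution
  set u₁ : ℝ := X * n ^ (4 - 4 * σ) with hu₁
  set u₂ : ℝ := X ^ (21 / 8 : ℝ) * T ^ (1 / 4 : ℝ) * n ^ (1 - 2 * σ) with hu₂
  set u₃ : ℝ := X ^ 3 * n ^ (1 - 2 * σ) with hu₃
  have hu₁0 : 0 ≤ u₁ := by positivity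
  have hu₂0 : 0 ≤ u₂ := by positivity
  have hu₃0 : 0 ≤ u₃ := by positivity
  have hE12 : E ^ (1 / 2 : ℝ) ≤ C₄ ^ (1 / 2 : ℝ) * L ^ (1 / 2 : ℝ) *
      (u₁ ^ (1 / 2 : ℝ) + u₂ ^ (1 / 2 : ℝ) + u₃ ^ (1 / 2 : ℝ)) := by
    calc E ^ (1 / 2 : ℝ) ≤ (C₄ * L * (u₁ + u₂ + u₃)) ^ (1 / 2 : ℝ) :=
          Real.rpow_le_rpow hE hEn (by norm_num)
      _ = C₄ ^ (1 / 2 : ℝ) * L ^ (1 / 2 : ℝ) * (u₁ + u₂ + u₃) ^ (1 / 2 : ℝ) := by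
          rw [Real.mul_rpow (by positivity) (by positivity), Real.mul_rpow hC₄ hL0]
      _ ≤ _ := by gcongr; exact rpow_half_add_three_le hu₁0 hu₂0 hu₃0
  -- the square roots
  have hsq₁ : u₁ ^ (1 / 2 : ℝ) = X ^ (1 / 2 : ℝ) * n ^ (2 - 2 * σ) := by
    rw [hu₁, Real.mul_rpow hX (by positivity), ← Real.rpow_mul hn0.le]; ring_nf
  have hsq₂ : u₂ ^ (1 / 2 : ℝ) = X ^ (21 / 16 : ℝ) * T ^ (1 / 8 : ℝ) * n ^ (1 / 2 - σ) := by
    rw [hu₂, Real.mul_rpow (by positivity) (by positivity), Real.mul_rpow (by positivity)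
      (by positivity), ← Real.rpow_mul hX, ← Real.rpow_mul hT0.le (1 / 4) (1 / 2),
      ← Real.rpow_mul hn0.le (1 - 2 * σ) (1 / 2)]
    congr 1
    · congr 1 <;> norm_num
    · ring_nf
  have hsq₃ : u₃ ^ (1 / 2 : ℝ) = X ^ (3 / 2 : ℝ) * n ^ (1 / 2 - σ) := by
    rw [hu₃, Real.mul_rpow (by positivity) (by positivity), ← Real.rpow_natCast X 3,
      ← Real.rpow_mul hX, ← Real.rpow_mul hn0.le]
    norm_num; left; ring_nf
  have hXX : X ^ (1 / 2 : ℝ) * X ^ (1 / 2 : ℝ) = X := by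
    rw [← Real.rpow_add' hX (by norm_num)]; norm_num
  have hX2116 : X ^ (1 / 2 : ℝ) * X ^ (21 / 16 : ℝ) = X ^ (29 / 16 : ℝ) := by
    rw [← Real.rpow_add' hX (by norm_num)]; norm_num
  have hX32 : X ^ (1 / 2 : ℝ) * X ^ (3 / 2 : ℝ) = X ^ 2 := by
    rw [← Real.rpow_add' hX (by norm_num)]; norm_num
  have hp₁ : T * n * X ^ (1 / 2 : ℝ) * u₁ ^ (1 / 2 : ℝ) = t₅ := by
    rw [hsq₁, ht₅]
    have : n * n ^ (2 - 2 * σ) = n ^ (3 - 2 * σ) := by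
      rw [show (3 : ℝ) - 2 * σ = (2 - 2 * σ) + 1 by ring, Real.rpow_add_one hn0.ne']; ring
    calc T * n * X ^ (1 / 2 : ℝ) * (X ^ (1 / 2 : ℝ) * n ^ (2 - 2 * σ))
        = T * (X ^ (1 / 2 : ℝ) * X ^ (1 / 2 : ℝ)) * (n * n ^ (2 - 2 * σ)) := by ring
      _ = T * X * n ^ (3 - 2 * σ) := by rw [hXX, this]
  have hp₂ : T * n * X ^ (1 / 2 : ℝ) * u₂ ^ (1 / 2 : ℝ) = t₇ := by
    rw [hsq₂, ht₇]
    have e1 : n * n ^ (1 / 2 - σ) = n ^ (3 / 2 - σ) := by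
      rw [show (3 : ℝ) / 2 - σ = (1 / 2 - σ) + 1 by ring, Real.rpow_add_one hn0.ne']; ring
    have e2 : T * T ^ (1 / 8 : ℝ) = T ^ (9 / 8 : ℝ) := by
      rw [show (9 : ℝ) / 8 = 1 / 8 + 1 by norm_num, Real.rpow_add_one hT0.ne']; ring
    calc T * n * X ^ (1 / 2 : ℝ) * (X ^ (21 / 16 : ℝ) * T ^ (1 / 8 : ℝ) * n ^ (1 / 2 - σ))
        = (T * T ^ (1 / 8 : ℝ)) * (X ^ (1 / 2 : ℝ) * X ^ (21 / 16 : ℝ)) * (n * n ^ (1 / 2 - σ)) := by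
          ring
      _ = T ^ (9 / 8 : ℝ) * X ^ (29 / 16 : ℝ) * n ^ (3 / 2 - σ) := by rw [e2, hX2116, e1]
  have hp₃ : T * n * X ^ (1 / 2 : ℝ) * u₃ ^ (1 / 2 : ℝ) = t₆ := by
    rw [hsq₃, ht₆]
    have e1 : n * n ^ (1 / 2 - σ) = n ^ (3 / 2 - σ) := by
      rw [show (3 : ℝ) / 2 - σ = (1 / 2 - σ) + 1 by ring, Real.rpow_add_one hn0.ne']; ring
    calc T * n * X ^ (1 / 2 : ℝ) * (X ^ (3 / 2 : ℝ) * n ^ (1 / 2 - σ))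
        = T * (X ^ (1 / 2 : ℝ) * X ^ (3 / 2 : ℝ)) * (n * n ^ (1 / 2 - σ)) := by ring
      _ = T * X ^ 2 * n ^ (3 / 2 - σ) := by rw [hX32, e1]
  -- assemble
  have h1 : T * n * X ^ (1 / 2 : ℝ) * E ^ (1 / 2 : ℝ) ≤
      C₄ ^ (1 / 2 : ℝ) * L ^ (1 / 2 : ℝ) * (t₅ + t₇ + t₆) := by
    calc T * n * X ^ (1 / 2 : ℝ) * E ^ (1 / 2 : ℝ)
        ≤ T * n * X ^ (1 / 2 : ℝ) * (C₄ ^ (1 / 2 : ℝ) * L ^ (1 / 2 : ℝ) *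
          (u₁ ^ (1 / 2 : ℝ) + u₂ ^ (1 / 2 : ℝ) + u₃ ^ (1 / 2 : ℝ))) := by gcongr
      _ = C₄ ^ (1 / 2 : ℝ) * L ^ (1 / 2 : ℝ) * (T * n * X ^ (1 / 2 : ℝ) * u₁ ^ (1 / 2 : ℝ) +
          T * n * X ^ (1 / 2 : ℝ) * u₂ ^ (1 / 2 : ℝ) + T * n * X ^ (1 / 2 : ℝ) * u₃ ^ (1 / 2 : ℝ)) := by
          ring
      _ = C₄ ^ (1 / 2 : ℝ) * L ^ (1 / 2 : ℝ) * (t₅ + t₇ + t₆) := by rw [hp₁, hp₂, hp₃]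
  have hC412 : 0 ≤ C₄ ^ (1 / 2 : ℝ) := by positivity
  have hL12' : 0 ≤ L ^ (1 / 2 : ℝ) := by positivity
  calc S₃ ≤ C₃ * L * (t₄ + T * n * X ^ (1 / 2 : ℝ) * E ^ (1 / 2 : ℝ)) := hS₃
    _ ≤ C₃ * L * (t₄ + C₄ ^ (1 / 2 : ℝ) * L ^ (1 / 2 : ℝ) * (t₅ + t₇ + t₆)) := by gcongr
    _ = C₃ * (L * t₄) + C₃ * C₄ ^ (1 / 2 : ℝ) * (L * L ^ (1 / 2 : ℝ)) * (t₅ + t₇ + t₆) := by ring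
    _ ≤ C₃ * (L ^ 2 * t₄) + C₃ * C₄ ^ (1 / 2 : ℝ) * L ^ 2 * (t₅ + t₇ + t₆) := by gcongr
    _ ≤ C₃ * (1 + C₄ ^ (1 / 2 : ℝ)) * L ^ 2 * (t₄ + t₅ + t₆ + t₇) := by
        have e : C₃ * (1 + C₄ ^ (1 / 2 : ℝ)) * L ^ 2 * (t₄ + t₅ + t₆ + t₇) -
            (C₃ * (L ^ 2 * t₄) + C₃ * C₄ ^ (1 / 2 : ℝ) * L ^ 2 * (t₅ + t₇ + t₆)) =
            C₃ * L ^ 2 * (t₅ + t₆ + t₇) + C₃ * C₄ ^ (1 / 2 : ℝ) * L ^ 2 * t₄ := by ring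
        have : 0 ≤ C₃ * L ^ 2 * (t₅ + t₆ + t₇) + C₃ * C₄ ^ (1 / 2 : ℝ) * L ^ 2 * t₄ := by positivity
        linarith

/-! ## Propositions 4.6 and 5.1 with `T` free (`N ≤ T ≤ N²`), constant uniform in `σ` -/

set_option maxHeartbeats 1600000 in
/-- **Guth–Maynard Propositions 4.6 and 5.1 packaged with `T` free** (the setting of eq. (12.1) /
Proposition 12.1: `W` in an interval of length `T`, `T^ε`-separated, `N ≤ T ≤ N²`), with the constant
UNIFORM in `σ`: for a smooth `w` supported in `[1,2]` and `ε > 0` there is `C` such that for every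
`N ≥ 1`, every `T` with `N ≤ T ≤ N²`, every real `σ`, every `1`-bounded `b_n` and every finite `W`
contained in an interval of length `T` and `T^ε`-separated with `|∑_n w(n/N) b_n n^{it}| ≥ N^σ` on `W`,
`|W| ≤ C (N^{2−2σ} + N^{1−2σ} |S₂ + S₃|^{1/3})`. Proof = the tree's
`GuthMaynardFourier.card_le_keyProp_setting` (the case `T = N^{6/5}`) re-run: Proposition 4.6
(`card_le_of_largeValues`) with the error budget `errR ≪ 1` from `norm_S0_sub_le`, `norm_S1_le`
(`j = ⌈8/ε⌉ + 9`, so that `(T^ε)^j ≥ T⁸` and `N^j ≥ N⁹ ≥ N³T³`) and `norm_coefB_le`, `|W| ≤ 2T`.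
[cite: GuthMaynard2026, Propositions 4.6 and 5.1; Section 12 (proof of Proposition 12.1)] -/
theorem card_le_freeT_setting {w : ℝ → ℝ} (hw : ContDiff ℝ ∞ w)
    (hsupp : Function.support w ⊆ Set.Icc 1 2) {ε : ℝ} (hε : 0 < ε) :
    ∃ C, 0 ≤ C ∧ ∀ N : ℕ, 1 ≤ N → ∀ T : ℝ, (N : ℝ) ≤ T → T ≤ (N : ℝ) ^ 2 →
      ∀ (σ : ℝ) (b : ℕ → ℂ) (t₀ : ℝ) (W : Finset ℝ), (∀ n, ‖b n‖ ≤ 1) →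
      (∀ t ∈ W, t₀ ≤ t ∧ t ≤ t₀ + T) →
      (∀ t ∈ W, ∀ t' ∈ W, t ≠ t' → T ^ ε ≤ |t - t'|) →
      (∀ t ∈ W, (N : ℝ) ^ σ ≤ ‖∑ n ∈ Finset.Icc N (2 * N),
        ((w ((n : ℝ) / N) : ℝ) : ℂ) * b n * (n : ℂ) ^ ((t : ℂ) * I)‖) →
      (W.card : ℝ) ≤ C * ((N : ℝ) ^ (2 - 2 * σ) +
        (N : ℝ) ^ (1 - 2 * σ) * ‖S2 w N W + S3 w N W‖ ^ (1 / 3 : ℝ)) := by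
  obtain ⟨C₁, hC₁0, hC₁⟩ := card_le_of_largeValues hw hsupp
  set j : ℕ := ⌈8 / ε⌉₊ + 9 with hj
  have hj9 : 9 ≤ j := by omega
  have hεj : 8 ≤ ε * j := by
    have h1 : 8 / ε ≤ ⌈8 / ε⌉₊ := Nat.le_ceil _
    have h2 : (⌈8 / ε⌉₊ : ℝ) ≤ j := by rw [hj]; push_cast; linarith
    have : 8 / ε ≤ j := h1.trans h2
    rwa [div_le_iff₀' hε] at this
  obtain ⟨C₂, hC₂0, hC₂⟩ := norm_S0_sub_le hw hsupp j
  obtain ⟨C₃, hC₃0, hC₃⟩ := norm_S1_le hw hsupp j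
  obtain ⟨C₄, hC₄0, hC₄⟩ := norm_coefB_le hw hsupp (j := 8) (by norm_num)
  set c : ℝ := ∫ u, (w u) ^ 2 with hc
  have hc0 : 0 ≤ c := integral_nonneg fun u ↦ sq_nonneg _
  set Q : ℝ := 3 * c ^ 2 + 3 * c * C₄ + C₄ ^ 2 with hQ
  set R₀ : ℝ := 8 * C₂ + 40 * C₃ + 2 * C₄ * Q with hR₀
  have hR₀0 : 0 ≤ R₀ := by positivity
  refine ⟨C₁ * (1 + R₀ ^ (1 / 3 : ℝ)), by positivity,
    fun N hN T hNT hTN σ b t₀ W hb hW hsep hlarge ↦ ?_⟩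
  have hN1 : (1 : ℝ) ≤ N := by exact_mod_cast hN
  have hN0 : (0 : ℝ) < N := by linarith
  set n : ℝ := (N : ℝ) with hn
  have hT1 : 1 ≤ T := hN1.trans hNT
  have hT0 : 0 < T := by linarith
  set δ : ℝ := T ^ ε with hδ
  have hδ1 : 1 ≤ δ := Real.one_le_rpow hT1 hε.le
  have hδ0 : 0 < δ := by linarith
  -- `|W| ≤ T + 1 ≤ 2T`
  have hcardW : (W.card : ℝ) ≤ 2 * T := by
    classical
    have hinj : Function.Injective (fun t : ℝ ↦ t - t₀) := sub_left_injective
    have hcard : (W.image (fun t ↦ t - t₀)).card = W.card := Finset.card_image_of_injective _ hinj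
    have h1 := GuthMaynardReduction.card_le_of_one_sep hT0.le (W.image (fun t ↦ t - t₀)) ?_ ?_
    · rw [hcard] at h1; linarith
    · intro t ht
      rw [Finset.mem_image] at ht
      obtain ⟨u, hu, rfl⟩ := ht
      have := hW u hu
      constructor <;> linarith [this.1, this.2]
    · intro t ht t' ht' hne
      rw [Finset.mem_image] at ht ht'
      obtain ⟨u, hu, rfl⟩ := ht
      obtain ⟨u', hu', rfl⟩ := ht'
      have hne' : u ≠ u' := fun h ↦ hne (by rw [h])
      have := hsep u hu u' hu' hne'
      rw [show u - t₀ - (u' - t₀) = u - u' by ring]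
      exact hδ1.trans this
  have hdiam : ∀ t ∈ W, ∀ t' ∈ W, |t - t'| ≤ T := by
    intro t ht t' ht'
    have h1 := hW t ht; have h2 := hW t' ht'
    rw [abs_sub_le_iff]; constructor <;> linarith [h1.1, h1.2, h2.1, h2.2]
  -- exponent bookkeeping (`n ≥ 1`, `n ≤ T ≤ n²`)
  have hpow_le : ∀ a b : ℝ, a ≤ b → n ^ a ≤ n ^ b := fun a b hab ↦
    Real.rpow_le_rpow_of_exponent_le hN1 hab
  have hTpow_le : ∀ a b : ℝ, a ≤ b → T ^ a ≤ T ^ b := fun a b hab ↦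
    Real.rpow_le_rpow_of_exponent_le hT1 hab
  have hD : T ^ (8 : ℝ) ≤ δ ^ j := by
    rw [hδ, ← Real.rpow_natCast, ← Real.rpow_mul hT0.le]
    exact hTpow_le _ _ (by linarith)
  have hD0 : 0 < T ^ (8 : ℝ) := by positivity
  have hn3T3 : n ^ 3 * T ^ 3 ≤ T ^ (6 : ℝ) := by
    rw [show (6 : ℝ) = ((6 : ℕ) : ℝ) by norm_num, Real.rpow_natCast]
    calc n ^ 3 * T ^ 3 ≤ T ^ 3 * T ^ 3 := by gcongr
      _ = T ^ 6 := by ring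
  have hT68 : T ^ (6 : ℝ) ≤ T ^ (8 : ℝ) := hTpow_le _ _ (by norm_num)
  -- (a) the `S₀` error
  have ha : ‖S0 w N W - (N : ℂ) ^ 3 * W.card * (coefA w 0) ^ 3‖ ≤ 8 * C₂ := by
    refine (hC₂ N W δ hδ0 hsep).trans ?_
    have h1 : C₂ * n ^ 3 * (W.card : ℝ) ^ 3 / δ ^ j ≤ C₂ * n ^ 3 * (2 * T) ^ 3 / T ^ (8 : ℝ) := by
      calc C₂ * n ^ 3 * (W.card : ℝ) ^ 3 / δ ^ j ≤ C₂ * n ^ 3 * (2 * T) ^ 3 / δ ^ j := by gcongr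
        _ ≤ C₂ * n ^ 3 * (2 * T) ^ 3 / T ^ (8 : ℝ) :=
            div_le_div_of_nonneg_left (by positivity) hD0 hD
    refine h1.trans ?_
    rw [mul_pow, show (2 : ℝ) ^ 3 = 8 by norm_num, div_le_iff₀ hD0]
    calc C₂ * n ^ 3 * (8 * T ^ 3) = 8 * C₂ * (n ^ 3 * T ^ 3) := by ring
      _ ≤ 8 * C₂ * T ^ (8 : ℝ) := by gcongr; exact hn3T3.trans hT68
  -- (b) the `S₁` error
  have hb' : ‖S1 w N W‖ ≤ 40 * C₃ := by
    refine (hC₃ N hN W δ T hδ0 hT0.le hsep hdiam).trans ?_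
    have h1 : (1 + T) ^ 2 / δ ^ j ≤ 4 * T ^ 2 / T ^ (8 : ℝ) := by
      calc (1 + T) ^ 2 / δ ^ j ≤ (2 * T) ^ 2 / δ ^ j := by gcongr; linarith
        _ ≤ (2 * T) ^ 2 / T ^ (8 : ℝ) := div_le_div_of_nonneg_left (by positivity) hD0 hD
        _ = 4 * T ^ 2 / T ^ (8 : ℝ) := by ring
    have h2 : 1 / n ^ j ≤ 1 / n ^ (9 : ℕ) :=
      div_le_div_of_nonneg_left zero_le_one (by positivity) (pow_le_pow_right₀ hN1 hj9)
    have h3 : n ^ 3 * (W.card : ℝ) ^ 3 ≤ 8 * (n ^ 3 * T ^ 3) := by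
      calc n ^ 3 * (W.card : ℝ) ^ 3 ≤ n ^ 3 * (2 * T) ^ 3 := by gcongr
        _ = 8 * (n ^ 3 * T ^ 3) := by ring
    have h4 : n ^ 3 * T ^ 3 * (4 * T ^ 2 / T ^ (8 : ℝ)) ≤ 4 := by
      rw [mul_div_assoc', div_le_iff₀ hD0]
      have e : n ^ 3 * T ^ 3 * (4 * T ^ 2) = 4 * (n ^ 3 * (T ^ 3 * T ^ 2)) := by ring
      rw [e]
      refine mul_le_mul_of_nonneg_left ?_ (by norm_num)
      calc n ^ 3 * (T ^ 3 * T ^ 2) ≤ T ^ 3 * (T ^ 3 * T ^ 2) := by gcongr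
        _ = T ^ ((8 : ℕ) : ℝ) := by rw [Real.rpow_natCast]; ring
        _ = T ^ (8 : ℝ) := by norm_num
    have h5 : n ^ 3 * T ^ 3 * (1 / n ^ (9 : ℕ)) ≤ 1 := by
      rw [mul_one_div, div_le_one (by positivity)]
      calc n ^ 3 * T ^ 3 ≤ n ^ 3 * (n ^ 2) ^ 3 := by gcongr
        _ = n ^ 9 := by ring
    calc C₃ * n ^ 3 * (W.card : ℝ) ^ 3 * ((1 + T) ^ 2 / δ ^ j + 1 / n ^ j)
        = C₃ * (n ^ 3 * (W.card : ℝ) ^ 3) * ((1 + T) ^ 2 / δ ^ j + 1 / n ^ j) := by ring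
      _ ≤ C₃ * (8 * (n ^ 3 * T ^ 3)) * (4 * T ^ 2 / T ^ (8 : ℝ) + 1 / n ^ (9 : ℕ)) := by
          gcongr
      _ = 8 * C₃ * (n ^ 3 * T ^ 3 * (4 * T ^ 2 / T ^ (8 : ℝ)) +
          n ^ 3 * T ^ 3 * (1 / n ^ (9 : ℕ))) := by ring
      _ ≤ 8 * C₃ * (4 + 1) := by gcongr
      _ = 40 * C₃ := by ring
  -- (c) the `tr(G)³` error
  have hβ : |(coefB w N 0).re| ≤ C₄ / n ^ (8 : ℕ) := by
    refine (Complex.abs_re_le_norm _).trans ((hC₄ 0 n hN1).trans ?_)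
    simp
  have hβ' : |(coefB w N 0).re| ≤ C₄ := by
    refine hβ.trans (div_le_self hC₄0 (one_le_pow₀ hN1))
  have hc' : (W.card : ℝ) * n ^ 3 * |(c + (coefB w N 0).re) ^ 3 - c ^ 3| ≤ 2 * C₄ * Q := by
    have h1 := abs_cube_sub_cube_le (β := (coefB w N 0).re) hc0
    have h2 : |(c + (coefB w N 0).re) ^ 3 - c ^ 3| ≤ C₄ / n ^ (8 : ℕ) * Q := by
      refine h1.trans ?_
      have hQ' : 3 * c ^ 2 + 3 * c * |(coefB w N 0).re| + (coefB w N 0).re ^ 2 ≤ Q := by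
        rw [hQ]
        have : 3 * c * |(coefB w N 0).re| ≤ 3 * c * C₄ :=
          mul_le_mul_of_nonneg_left hβ' (by positivity)
        have hb2 : (coefB w N 0).re ^ 2 ≤ C₄ ^ 2 := by
          rw [← sq_abs]; exact pow_le_pow_left₀ (abs_nonneg _) hβ' 2
        linarith
      exact mul_le_mul hβ hQ' (by positivity) (by positivity)
    have h3 : (W.card : ℝ) * n ^ 3 ≤ 2 * n ^ (8 : ℕ) := by
      calc (W.card : ℝ) * n ^ 3 ≤ 2 * T * n ^ 3 := by gcongr
        _ ≤ 2 * n ^ 2 * n ^ 3 := by gcongr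
        _ = 2 * (n ^ 5 * 1) := by ring
        _ ≤ 2 * (n ^ 5 * n ^ 3) := by gcongr; exact one_le_pow₀ hN1
        _ = 2 * n ^ (8 : ℕ) := by ring
    have hn8 : 0 < n ^ (8 : ℕ) := by positivity
    calc (W.card : ℝ) * n ^ 3 * |(c + (coefB w N 0).re) ^ 3 - c ^ 3|
        ≤ (2 * n ^ (8 : ℕ)) * (C₄ / n ^ (8 : ℕ) * Q) := by gcongr
      _ = 2 * C₄ * Q := by field_simp
  -- so `R ≤ R₀`
  have hR : errR w N W ≤ R₀ := by
    rw [errR, hR₀]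
    have := ha; have := hb'; have := hc'
    linarith
  -- conclude
  have hmain := hC₁ N hN σ b W hb hlarge
  have hR3 : (errR w N W) ^ (1 / 3 : ℝ) ≤ R₀ ^ (1 / 3 : ℝ) :=
    Real.rpow_le_rpow (errR_nonneg w N W) hR (by norm_num)
  have h12 : n ^ (1 - 2 * σ) ≤ n ^ (2 - 2 * σ) := hpow_le _ _ (by linarith)
  set S : ℝ := ‖S2 w N W + S3 w N W‖ ^ (1 / 3 : ℝ) with hS
  have hS0 : 0 ≤ S := by positivity
  have hR₀3 : 0 ≤ R₀ ^ (1 / 3 : ℝ) := by positivity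
  have hE3 : 0 ≤ (errR w N W) ^ (1 / 3 : ℝ) := Real.rpow_nonneg (errR_nonneg w N W) _
  calc (W.card : ℝ) ≤ C₁ * (n ^ (2 - 2 * σ) + n ^ (1 - 2 * σ) * S +
        n ^ (1 - 2 * σ) * (errR w N W) ^ (1 / 3 : ℝ)) := hmain
    _ ≤ C₁ * (n ^ (2 - 2 * σ) + n ^ (1 - 2 * σ) * S + n ^ (2 - 2 * σ) * R₀ ^ (1 / 3 : ℝ)) := by
        gcongr
    _ ≤ C₁ * (1 + R₀ ^ (1 / 3 : ℝ)) * (n ^ (2 - 2 * σ) + n ^ (1 - 2 * σ) * S) := by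
        have h1 : 0 ≤ n ^ (2 - 2 * σ) := by positivity
        have h2 : 0 ≤ n ^ (1 - 2 * σ) * S := by positivity
        nlinarith [mul_nonneg hC₁0 hR₀3, mul_nonneg (mul_nonneg hC₁0 hR₀3) h2]

/-! ## Eq. (12.1) in the setting of the key proposition, `T` and `k` free -/

/-- `w(1) = 0` for a continuous `w` supported in `[1, 2]`; private plumbing. [folklore] -/
private lemma weight_one_eq_zero {w : ℝ → ℝ} (hw : Continuous w)
    (hsupp : Function.support w ⊆ Set.Icc 1 2) : w 1 = 0 := by
  have hZ : IsClosed {x : ℝ | w x = 0} := isClosed_eq hw continuous_const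
  have hsub : Set.Iio (1 : ℝ) ⊆ {x | w x = 0} := by
    intro x hx
    by_contra h
    have hx' : x ∈ Function.support w := h
    exact absurd (hsupp hx').1 (not_le.2 hx)
  have h1 : (1 : ℝ) ∈ closure (Set.Iio (1 : ℝ)) := by
    rw [closure_Iio]; exact Set.self_mem_Iic
  exact hZ.closure_subset_iff.2 hsub h1

/-- With `w(1) = 0` the term `n = N` of the weighted sum drops:
`∑_{N ≤ n ≤ 2N} w(n/N) b_n n^{it} = ∑_{N < n ≤ 2N} w(n/N) b_n n^{it}`; private plumbing. [folklore] -/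
private lemma sum_Icc_eq_sum_Ioc_of_weight {w : ℝ → ℝ} (hw1 : w 1 = 0) {N : ℕ} (hN : 1 ≤ N)
    (b : ℕ → ℂ) (t : ℝ) :
    ∑ n ∈ Finset.Icc N (2 * N), ((w ((n : ℝ) / N) : ℝ) : ℂ) * b n * (n : ℂ) ^ ((t : ℂ) * I) =
      ∑ n ∈ Finset.Ioc N (2 * N), ((w ((n : ℝ) / N) : ℝ) : ℂ) * b n * (n : ℂ) ^ ((t : ℂ) * I) := by
  rw [← Finset.Ioc_insert_left (by omega : N ≤ 2 * N), Finset.sum_insert Finset.left_notMem_Ioc]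
  have hN0 : (N : ℝ) ≠ 0 := by positivity
  rw [div_self hN0, hw1]
  push_cast
  ring

set_option maxHeartbeats 1600000 in
/-- **Guth–Maynard eq. (12.1) ("FullBound") in the setting of the key proposition, with `T` and
`k` free.** Let `w` be the cutoff of §3 (smooth, supported in `[1,2]`, `= 1` on `[6/5, 9/5]`, values
in `[0,1]`) and assume Propositions 6.1 and 10.1 as printed with `T` free (`h61`, `h101`: the tree's
`GuthMaynard2026_proposition_6_1`, `GuthMaynard2026_proposition_10_1`, both proved) and Proposition
11.1 as printed (`h111`, the statement of `GuthMaynard2026_proposition_11_1`, proved in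
`GuthMaynardEnergyBoundAsPrinted.lean`). Then for every `k ≥ 1`, `ε > 0`, `δ > 0` there are `C, T₀`
such that for `T ≥ T₀`, `T^{3/4} ≤ N ≤ T`, every real `σ`, every `1`-bounded `b_n` and every `W`
contained in an interval of length `T` and `T^ε`-separated with `|∑_n w(n/N) b_n n^{it}| ≥ N^σ` on
`W`: `|W| ≤ C T^δ (N^{2−2σ} + N^{5−6σ} + T^{k/(k+1)}N^{(4−6σ)k/(k+1)} + N^{(5−6σ)4k/(4k+3)}T^{2/(4k+3)}
+ T^{4/3}N^{2−4σ} + T^{1/2}N^{3−4σ} + TN^{9/2−7σ} + T^{18/19}N^{(72−112σ)/19})`, the constant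
uniform in `σ` (it depends on `w, k, ε, δ`). Proof as printed: "By Proposition 4.6 and (4.?) …
`|W|³N^{6σ−3} ⪅_ε N³ + S₂ + S₃ ⪅_{ε,k} [seven terms]` … The last inequality rearranges to give
(12.1)": `card_le_freeT_setting` (Props. 4.6/5.1), `h61`, `h101` + `h111` through
`S3_numeric_freeT` (Prop. 11.2; the weighted coefficients `w(n/N)b_n` are `1`-bounded and the term
`n = N` vanishes as `w(1) = 0`), and `GuthMaynardAssemblyFreeT.fullBound_of_bounds` (the
rearrangement, constant uniform in `k, σ`). The range `T^{3/4} ≤ N` is that of Proposition 11.1.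
[cite: GuthMaynard2026, Section 12, eq. (12.1)] -/
theorem fullBound_keyProp_setting {w : ℝ → ℝ} (hw : ContDiff ℝ ∞ w)
    (hsupp : Function.support w ⊆ Set.Icc 1 2) (hw1 : ∀ u : ℝ, 6 / 5 ≤ u → u ≤ 9 / 5 → w u = 1)
    (hw01 : ∀ u : ℝ, 0 ≤ w u ∧ w u ≤ 1)
    (h61 : GuthMaynard2026_proposition_6_1) (h101 : GuthMaynard2026_proposition_10_1)
    (h111 : ∀ ε : ℝ, 0 < ε → ∃ C T₀ : ℝ, ∀ T : ℝ, T₀ ≤ T → ∀ N : ℕ, T ^ (3 / 4 : ℝ) ≤ (N : ℝ) →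
      (N : ℝ) ≤ T → ∀ (σ : ℝ) (b : ℕ → ℂ) (t₀ : ℝ) (W : Finset ℝ), (∀ n, ‖b n‖ ≤ 1) →
      (∀ t ∈ W, t₀ ≤ t ∧ t ≤ t₀ + T) → (∀ t ∈ W, ∀ t' ∈ W, t ≠ t' → 1 ≤ |t - t'|) →
      (∀ t ∈ W, (N : ℝ) ^ σ ≤ ‖∑ n ∈ Finset.Ioc N (2 * N), b n * (n : ℂ) ^ ((t : ℂ) * I)‖) →
      GuthMaynardAssembly.addEnergy W ≤ C * T ^ ε * ((W.card : ℝ) * (N : ℝ) ^ (4 - 4 * σ) +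
        (W.card : ℝ) ^ (21 / 8 : ℝ) * T ^ (1 / 4 : ℝ) * (N : ℝ) ^ (1 - 2 * σ) +
        (W.card : ℝ) ^ 3 * (N : ℝ) ^ (1 - 2 * σ))) :
    ∀ k : ℕ, 1 ≤ k → ∀ ε : ℝ, 0 < ε → ∀ δ : ℝ, 0 < δ → ∃ C T₀ : ℝ, 0 ≤ C ∧ ∀ T : ℝ, T₀ ≤ T →
      ∀ N : ℕ, T ^ (3 / 4 : ℝ) ≤ (N : ℝ) → (N : ℝ) ≤ T →
      ∀ (σ : ℝ) (b : ℕ → ℂ) (t₀ : ℝ) (W : Finset ℝ), (∀ n, ‖b n‖ ≤ 1) →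
      (∀ t ∈ W, t₀ ≤ t ∧ t ≤ t₀ + T) → (∀ t ∈ W, ∀ t' ∈ W, t ≠ t' → T ^ ε ≤ |t - t'|) →
      (∀ t ∈ W, (N : ℝ) ^ σ ≤ ‖∑ n ∈ Finset.Icc N (2 * N), ((w ((n : ℝ) / N) : ℝ) : ℂ) * b n *
        (n : ℂ) ^ ((t : ℂ) * I)‖) →
      (W.card : ℝ) ≤ C * T ^ δ * ((N : ℝ) ^ (2 - 2 * σ) + (N : ℝ) ^ (5 - 6 * σ) +
        T ^ ((k : ℝ) / ((k : ℝ) + 1)) * (N : ℝ) ^ ((4 - 6 * σ) * ((k : ℝ) / ((k : ℝ) + 1))) +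
        (N : ℝ) ^ ((5 - 6 * σ) * (4 * (k : ℝ) / (4 * (k : ℝ) + 3))) * T ^ (2 / (4 * (k : ℝ) + 3)) +
        T ^ (4 / 3 : ℝ) * (N : ℝ) ^ (2 - 4 * σ) + T ^ (1 / 2 : ℝ) * (N : ℝ) ^ (3 - 4 * σ) +
        T * (N : ℝ) ^ (9 / 2 - 7 * σ) + T ^ (18 / 19 : ℝ) * (N : ℝ) ^ ((72 - 112 * σ) / 19)) := by
  intro k hk ε hε δ hδ
  obtain ⟨C₀, hC₀0, hC₀⟩ := card_le_freeT_setting hw hsupp hε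
  set δ' : ℝ := δ / 4 with hδ'
  have hδ'0 : 0 < δ' := by positivity
  obtain ⟨C₆, T₆, h6⟩ := h61 w hw hsupp hw1 hw01 k hk ε hε δ' hδ'0
  obtain ⟨C₁₀, T₁₀, h10⟩ := h101 w hw hsupp hw1 hw01 ε hε δ' hδ'0
  obtain ⟨C₁₁, T₁₁, h11⟩ := h111 δ' hδ'0
  set C₆' : ℝ := max C₆ 0 with hC₆'
  set C₁₀' : ℝ := max C₁₀ 0 with hC₁₀'
  set C₁₁' : ℝ := max C₁₁ 0 with hC₁₁'
  have hC₆'0 : 0 ≤ C₆' := le_max_right _ _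
  have hC₁₀'0 : 0 ≤ C₁₀' := le_max_right _ _
  have hC₁₁'0 : 0 ≤ C₁₁' := le_max_right _ _
  obtain ⟨C, hC0, hC⟩ := GuthMaynardAssemblyFreeT.fullBound_of_bounds C₀
    (C₆' + C₁₀' * (1 + C₁₁' ^ (1 / 2 : ℝ))) hC₀0 (by positivity)
  refine ⟨C, max (max T₆ T₁₀) (max T₁₁ 1), hC0,
    fun T hT N hN34 hNT σ b t₀ W hb hW hsep hlarge ↦ ?_⟩
  have hT6 : T₆ ≤ T := le_trans ((le_max_left _ _).trans (le_max_left _ _)) hT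
  have hT10 : T₁₀ ≤ T := le_trans ((le_max_right _ _).trans (le_max_left _ _)) hT
  have hT11 : T₁₁ ≤ T := le_trans ((le_max_left _ _).trans (le_max_right _ _)) hT
  have hT1 : (1 : ℝ) ≤ T := le_trans ((le_max_right _ _).trans (le_max_right _ _)) hT
  have hT0 : 0 < T := by linarith
  have hN1r : (1 : ℝ) ≤ N := (Real.one_le_rpow hT1 (by norm_num)).trans hN34
  have hN1 : 1 ≤ N := by exact_mod_cast hN1r
  have hN0 : (0 : ℝ) < N := by linarith
  -- `T ≤ N²` (`T = (T^{3/4})^{4/3} ≤ N^{4/3} ≤ N²`)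
  have hTN2 : T ≤ (N : ℝ) ^ 2 := by
    have h1 : (T ^ (3 / 4 : ℝ)) ^ (4 / 3 : ℝ) = T := by
      rw [← Real.rpow_mul hT0.le]; norm_num
    have h2 : (T ^ (3 / 4 : ℝ)) ^ (4 / 3 : ℝ) ≤ (N : ℝ) ^ (4 / 3 : ℝ) :=
      Real.rpow_le_rpow (by positivity) hN34 (by norm_num)
    have h3 : (N : ℝ) ^ (4 / 3 : ℝ) ≤ (N : ℝ) ^ ((2 : ℕ) : ℝ) :=
      Real.rpow_le_rpow_of_exponent_le hN1r (by norm_num)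
    rw [Real.rpow_natCast] at h3
    linarith
  set n : ℝ := (N : ℝ) with hn
  set X : ℝ := (W.card : ℝ) with hX
  have hX0 : 0 ≤ X := by positivity
  set S : ℝ := ‖S2 w N W + S3 w N W‖ with hS
  have hS0 : 0 ≤ S := norm_nonneg _
  set L : ℝ := T ^ δ' with hL
  have hL1 : 1 ≤ L := Real.one_le_rpow hT1 hδ'0.le
  have hL0 : 0 < L := by linarith
  have hE0 : 0 ≤ GuthMaynardAssembly.addEnergy W := GuthMaynardAssembly.addEnergy_nonneg W
  -- Propositions 4.6 / 5.1
  have h46 := hC₀ N hN1 T hNT hTN2 σ b t₀ W hb hW hsep hlarge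
  -- `1`-separation
  have hsep1 : ∀ t ∈ W, ∀ t' ∈ W, t ≠ t' → 1 ≤ |t - t'| := fun t ht t' ht' hne ↦
    (Real.one_le_rpow hT1 hε.le).trans (hsep t ht t' ht' hne)
  -- Proposition 6.1 (the printed third term in product form)
  have hS2 : ‖S2 w N W‖ ≤ C₆' * L * (n ^ 2 * X ^ 2 + T * n * X ^ (2 - 1 / (k : ℝ)) +
      n ^ 2 * T ^ (1 / (2 * (k : ℝ))) * X ^ (2 - 3 / (4 * (k : ℝ)))) := by
    have h := h6 T hT6 N hN1 hNT t₀ W hW hsep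
    rw [GuthMaynard2026_proposition_6_1.third_term_eq hk hT0.le hX0] at h
    refine h.trans ?_
    have hpos : 0 ≤ n ^ 2 * X ^ 2 + T * n * X ^ (2 - 1 / (k : ℝ)) +
        n ^ 2 * T ^ (1 / (2 * (k : ℝ))) * X ^ (2 - 3 / (4 * (k : ℝ))) := by positivity
    exact mul_le_mul_of_nonneg_right (mul_le_mul_of_nonneg_right (le_max_left _ _) hL0.le) hpos
  -- Proposition 10.1
  have hS3 : ‖S3 w N W‖ ≤ C₁₀' * L * (T ^ 2 * X ^ (3 / 2 : ℝ) +
      T * n * X ^ (1 / 2 : ℝ) * (GuthMaynardAssembly.addEnergy W) ^ (1 / 2 : ℝ)) := by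
    have h := h10 T hT10 N hN1 hNT t₀ W hW hsep
    refine h.trans ?_
    have hpos : 0 ≤ T ^ 2 * X ^ (3 / 2 : ℝ) + T * n * X ^ (1 / 2 : ℝ) * (GuthMaynardAssembly.addEnergy W) ^ (1 / 2 : ℝ) := by
      positivity
    exact mul_le_mul_of_nonneg_right (mul_le_mul_of_nonneg_right (le_max_left _ _) hL0.le) hpos
  -- Proposition 11.1 for the `1`-bounded coefficients `w(n/N) b_n` on `(N, 2N]`
  set b' : ℕ → ℂ := fun m ↦ ((w ((m : ℝ) / N) : ℝ) : ℂ) * b m with hb'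
  have hb'1 : ∀ m, ‖b' m‖ ≤ 1 := by
    intro m
    rw [hb']
    dsimp only
    rw [norm_mul, Complex.norm_real, Real.norm_eq_abs, abs_of_nonneg (hw01 _).1]
    calc w ((m : ℝ) / N) * ‖b m‖ ≤ 1 * 1 :=
          mul_le_mul (hw01 _).2 (hb m) (norm_nonneg _) zero_le_one
      _ = 1 := one_mul _
  have hw10 : w 1 = 0 := weight_one_eq_zero hw.continuous hsupp
  have hlarge' : ∀ t ∈ W, n ^ σ ≤ ‖∑ m ∈ Finset.Ioc N (2 * N), b' m * (m : ℂ) ^ ((t : ℂ) * I)‖ := by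
    intro t ht
    have h := hlarge t ht
    rw [sum_Icc_eq_sum_Ioc_of_weight hw10 hN1 b t] at h
    exact h
  have hE : GuthMaynardAssembly.addEnergy W ≤ C₁₁' * L * (X * n ^ (4 - 4 * σ) +
      X ^ (21 / 8 : ℝ) * T ^ (1 / 4 : ℝ) * n ^ (1 - 2 * σ) + X ^ 3 * n ^ (1 - 2 * σ)) := by
    have h := h11 T hT11 N hN34 hNT σ b' t₀ W hb'1 hW hsep1 hlarge'
    refine h.trans ?_
    have hpos : 0 ≤ X * n ^ (4 - 4 * σ) + X ^ (21 / 8 : ℝ) * T ^ (1 / 4 : ℝ) * n ^ (1 - 2 * σ) +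
        X ^ 3 * n ^ (1 - 2 * σ) := by positivity
    exact mul_le_mul_of_nonneg_right (mul_le_mul_of_nonneg_right (le_max_left _ _) hL0.le) hpos
  -- Proposition 11.2 numerically
  have hS3' := S3_numeric_freeT hC₁₀'0 hC₁₁'0 hN1r hT1 hL1 hX0 hE0 hS3 hE
  -- `S ≤ |S₂| + |S₃| ≤ C₁ L² (seven terms)`
  have hL2 : L ≤ L ^ 2 := by nlinarith
  have ht1 : 0 ≤ n ^ 2 * X ^ 2 := by positivity
  have ht2 : 0 ≤ T * n * X ^ (2 - 1 / (k : ℝ)) := by positivity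
  have ht3 : 0 ≤ n ^ 2 * T ^ (1 / (2 * (k : ℝ))) * X ^ (2 - 3 / (4 * (k : ℝ))) := by positivity
  have ht4 : 0 ≤ T ^ 2 * X ^ (3 / 2 : ℝ) := by positivity
  have ht5 : 0 ≤ T * X * n ^ (3 - 2 * σ) := by positivity
  have ht6 : 0 ≤ T * X ^ 2 * n ^ (3 / 2 - σ) := by positivity
  have ht7 : 0 ≤ T ^ (9 / 8 : ℝ) * X ^ (29 / 16 : ℝ) * n ^ (3 / 2 - σ) := by positivity
  have hC' : 0 ≤ C₁₀' * (1 + C₁₁' ^ (1 / 2 : ℝ)) := by positivity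
  have hSle : S ≤ (C₆' + C₁₀' * (1 + C₁₁' ^ (1 / 2 : ℝ))) * L ^ 2 *
      (n ^ 2 * X ^ 2 + T * n * X ^ (2 - 1 / (k : ℝ)) +
        n ^ 2 * T ^ (1 / (2 * (k : ℝ))) * X ^ (2 - 3 / (4 * (k : ℝ))) +
        T ^ 2 * X ^ (3 / 2 : ℝ) + T * X * n ^ (3 - 2 * σ) + T * X ^ 2 * n ^ (3 / 2 - σ) +
        T ^ (9 / 8 : ℝ) * X ^ (29 / 16 : ℝ) * n ^ (3 / 2 - σ)) := by
    have h1 : S ≤ ‖S2 w N W‖ + ‖S3 w N W‖ := norm_add_le _ _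
    have h2 : C₆' * L * (n ^ 2 * X ^ 2 + T * n * X ^ (2 - 1 / (k : ℝ)) +
        n ^ 2 * T ^ (1 / (2 * (k : ℝ))) * X ^ (2 - 3 / (4 * (k : ℝ)))) ≤
        C₆' * L ^ 2 * (n ^ 2 * X ^ 2 + T * n * X ^ (2 - 1 / (k : ℝ)) +
        n ^ 2 * T ^ (1 / (2 * (k : ℝ))) * X ^ (2 - 3 / (4 * (k : ℝ)))) := by gcongr
    have h4 : 0 ≤ C₆' * L ^ 2 * (T ^ 2 * X ^ (3 / 2 : ℝ) + T * X * n ^ (3 - 2 * σ) +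
        T * X ^ 2 * n ^ (3 / 2 - σ) + T ^ (9 / 8 : ℝ) * X ^ (29 / 16 : ℝ) * n ^ (3 / 2 - σ)) := by
      positivity
    have h5 : 0 ≤ C₁₀' * (1 + C₁₁' ^ (1 / 2 : ℝ)) * L ^ 2 * (n ^ 2 * X ^ 2 +
        T * n * X ^ (2 - 1 / (k : ℝ)) + n ^ 2 * T ^ (1 / (2 * (k : ℝ))) * X ^ (2 - 3 / (4 * (k : ℝ)))) := by
      positivity
    linarith [h1, hS2, h2, hS3', h4, h5]
  -- the rearrangement (12.1)
  have hL21 : 1 ≤ L ^ 2 := by nlinarith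
  have hmain := hC k σ n T (L ^ 2) X S hk hN1r hT1 hL21 hX0 hS0 h46 hSle
  -- `L² = T^{δ/2} ≤ T^δ`
  have hLT : L ^ 2 ≤ T ^ δ := by
    rw [hL, ← Real.rpow_natCast, ← Real.rpow_mul hT0.le]
    exact Real.rpow_le_rpow_of_exponent_le hT1 (by rw [hδ']; push_cast; linarith)
  have hpos8 : 0 ≤ n ^ (2 - 2 * σ) + n ^ (5 - 6 * σ) +
      T ^ ((k : ℝ) / ((k : ℝ) + 1)) * n ^ ((4 - 6 * σ) * ((k : ℝ) / ((k : ℝ) + 1))) +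
      n ^ ((5 - 6 * σ) * (4 * (k : ℝ) / (4 * (k : ℝ) + 3))) * T ^ (2 / (4 * (k : ℝ) + 3)) +
      T ^ (4 / 3 : ℝ) * n ^ (2 - 4 * σ) + T ^ (1 / 2 : ℝ) * n ^ (3 - 4 * σ) +
      T * n ^ (9 / 2 - 7 * σ) + T ^ (18 / 19 : ℝ) * n ^ ((72 - 112 * σ) / 19) := by positivity
  exact hmain.trans (mul_le_mul_of_nonneg_right (mul_le_mul_of_nonneg_left hLT hC0) hpos8)

/-! ## Eq. (12.1) for unweighted Dirichlet polynomials on `1`-separated sets (the reduction of §3) -/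

/-- Conversion of one term of (12.1) from a piece `(N', T', σ')` (`N' ≤ 2N`, `T' ≤ 2T`,
`N'^{σ'} = N^σ/3`) back to `(N, T, σ)`: `T'^a N'^{b − cσ'} ≤ 2^a 2^b 3^c · T^a N^{b − cσ}` for
`0 ≤ a ≤ 2`, `0 ≤ b ≤ 6`, `c ≤ 8`; private plumbing. [folklore] -/
private lemma term_le {T T' N N' σ σ' a b c : ℝ} (hT : 1 ≤ T) (hT'0 : 0 ≤ T') (hT' : T' ≤ 2 * T)
    (hN : 0 < N) (hN' : 0 < N') (hN'N : N' ≤ 2 * N) (hV : N' ^ σ' = N ^ σ / 3)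
    (ha0 : 0 ≤ a) (ha : a ≤ 2) (hb0 : 0 ≤ b) (hb : b ≤ 6) (hc : c ≤ 8) :
    T' ^ a * N' ^ (b - c * σ') ≤ 1679616 * (T ^ a * N ^ (b - c * σ)) := by
  have hT0 : 0 < T := by linarith
  have hP0 : 0 < (N ^ σ) ^ c := by positivity
  have e1 : N' ^ (b - c * σ') = N' ^ b * (3 : ℝ) ^ c / (N ^ σ) ^ c := by
    rw [Real.rpow_sub hN', show c * σ' = σ' * c by ring, Real.rpow_mul hN'.le, hV,
      Real.div_rpow (by positivity) (by norm_num)]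
    field_simp
  have e2 : N ^ (b - c * σ) = N ^ b / (N ^ σ) ^ c := by
    rw [Real.rpow_sub hN, show c * σ = σ * c by ring, Real.rpow_mul hN.le]
  have h1 : T' ^ a ≤ 4 * T ^ a := by
    calc T' ^ a ≤ (2 * T) ^ a := Real.rpow_le_rpow hT'0 hT' ha0
      _ = (2 : ℝ) ^ a * T ^ a := Real.mul_rpow (by norm_num) hT0.le
      _ ≤ (2 : ℝ) ^ (2 : ℝ) * T ^ a :=
          mul_le_mul_of_nonneg_right (Real.rpow_le_rpow_of_exponent_le (by norm_num) ha)
            (by positivity)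
      _ = 4 * T ^ a := by norm_num
  have h2 : N' ^ b ≤ 64 * N ^ b := by
    calc N' ^ b ≤ (2 * N) ^ b := Real.rpow_le_rpow hN'.le hN'N hb0
      _ = (2 : ℝ) ^ b * N ^ b := Real.mul_rpow (by norm_num) hN.le
      _ ≤ (2 : ℝ) ^ (6 : ℝ) * N ^ b :=
          mul_le_mul_of_nonneg_right (Real.rpow_le_rpow_of_exponent_le (by norm_num) hb)
            (by positivity)
      _ = 64 * N ^ b := by norm_num
  have h3 : (3 : ℝ) ^ c ≤ 6561 := by
    calc (3 : ℝ) ^ c ≤ (3 : ℝ) ^ (8 : ℝ) :=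
          Real.rpow_le_rpow_of_exponent_le (by norm_num : (1 : ℝ) ≤ 3) hc
      _ = 6561 := by norm_num
  rw [e1, e2]
  have hTa : 0 ≤ T ^ a := by positivity
  have hNb : 0 ≤ N ^ b := by positivity
  have h3c : 0 ≤ (3 : ℝ) ^ c := by positivity
  have hT'a : 0 ≤ T' ^ a := by positivity
  have hN'b : 0 ≤ N' ^ b := by positivity
  rw [mul_div_assoc', mul_div_assoc', ← mul_div_assoc, div_le_div_iff_of_pos_right hP0]
  calc T' ^ a * (N' ^ b * (3 : ℝ) ^ c) ≤ (4 * T ^ a) * ((64 * N ^ b) * 6561) := by gcongr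
    _ = 1679616 * (T ^ a * N ^ b) := by ring

set_option maxHeartbeats 3200000 in
/-- **Eq. (12.1) for an unweighted Dirichlet polynomial on a `1`-separated set** (the form in
which (12.1) enters the proof of Proposition 12.1: "Suppose `(b_n)`, `(t_r)` are as in Theorem 1.1,
and that `T^{5/6} ≤ N ≤ T` …"). If `w = 1` on `[6/5, 9/5]` and (12.1) holds in the setting of the
key proposition for `w` and a fixed `k` (hypothesis `hFB`, the conclusion of
`fullBound_keyProp_setting`), then for every `ε > 0` there are `C, T₀` such that for `T ≥ T₀`,
`T^{5/6} ≤ N ≤ T`, every real `σ`, `|b_n| ≤ 1` and every `1`-separated `W ⊂ [0, T]` with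
`|∑_{N ≤ n ≤ 2N} b_n n^{it}| ≥ N^σ` on `W`, `|W| ≤ C T^ε (N^{2−2σ} + N^{5−6σ} + T^{k/(k+1)}N^{(4−6σ)k/(k+1)}
+ N^{(5−6σ)4k/(4k+3)}T^{2/(4k+3)} + T^{4/3}N^{2−4σ} + T^{1/2}N^{3−4σ} + TN^{9/2−7σ} + T^{18/19}N^{(72−112σ)/19})`.
The reduction is that of §3 of the paper (`GuthMaynardReduction`): split `[N, 2N]` into three
pieces (`norm_sum_Icc_le_three_pieces`), insert `w(n/N')` with `N' = ⌊5N/6⌋, N, ⌈10N/9⌉`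
(`sum_weight_indicator_eq`), thin to `(2T)^{ε/3}`-separated subsets in windows of length `2T`
(`card_le_of_sep_of_short`) and apply `hFB` at `(2T, N', σ')` with `N'^{σ'} = N^σ/3` (the constant
of `hFB` being uniform in `σ`, no grid in `σ` is needed); each term at `(N', 2T, σ')` is at most
`2^{12}3^8` times the term at `(N, T, σ)`. `T ≥ 2^{60}` makes `(2T)^{3/4} ≤ ⌊5N/6⌋`.
[cite: GuthMaynard2026, Section 12 (proof of Proposition 12.1) with Section 3] -/
theorem largeValues_of_fullBound {w : ℝ → ℝ} (hw : ∀ u : ℝ, 6 / 5 ≤ u → u ≤ 9 / 5 → w u = 1)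
    {k : ℕ}
    (hFB : ∀ ε : ℝ, 0 < ε → ∀ δ : ℝ, 0 < δ → ∃ C T₀ : ℝ, 0 ≤ C ∧ ∀ T : ℝ, T₀ ≤ T →
      ∀ N : ℕ, T ^ (3 / 4 : ℝ) ≤ (N : ℝ) → (N : ℝ) ≤ T →
      ∀ (σ : ℝ) (b : ℕ → ℂ) (t₀ : ℝ) (W : Finset ℝ), (∀ n, ‖b n‖ ≤ 1) →
      (∀ t ∈ W, t₀ ≤ t ∧ t ≤ t₀ + T) → (∀ t ∈ W, ∀ t' ∈ W, t ≠ t' → T ^ ε ≤ |t - t'|) →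
      (∀ t ∈ W, (N : ℝ) ^ σ ≤ ‖∑ n ∈ Finset.Icc N (2 * N), ((w ((n : ℝ) / N) : ℝ) : ℂ) * b n *
        (n : ℂ) ^ ((t : ℂ) * I)‖) →
      (W.card : ℝ) ≤ C * T ^ δ * ((N : ℝ) ^ (2 - 2 * σ) + (N : ℝ) ^ (5 - 6 * σ) +
        T ^ ((k : ℝ) / ((k : ℝ) + 1)) * (N : ℝ) ^ ((4 - 6 * σ) * ((k : ℝ) / ((k : ℝ) + 1))) +
        (N : ℝ) ^ ((5 - 6 * σ) * (4 * (k : ℝ) / (4 * (k : ℝ) + 3))) * T ^ (2 / (4 * (k : ℝ) + 3)) +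
        T ^ (4 / 3 : ℝ) * (N : ℝ) ^ (2 - 4 * σ) + T ^ (1 / 2 : ℝ) * (N : ℝ) ^ (3 - 4 * σ) +
        T * (N : ℝ) ^ (9 / 2 - 7 * σ) + T ^ (18 / 19 : ℝ) * (N : ℝ) ^ ((72 - 112 * σ) / 19))) :
    ∀ ε : ℝ, 0 < ε → ∃ C T₀ : ℝ, 0 ≤ C ∧ ∀ T : ℝ, T₀ ≤ T →
      ∀ (N : ℕ) (σ : ℝ) (b : ℕ → ℂ) (W : Finset ℝ), T ^ (5 / 6 : ℝ) ≤ (N : ℝ) → (N : ℝ) ≤ T →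
      (∀ n, ‖b n‖ ≤ 1) → (∀ t ∈ W, 0 ≤ t ∧ t ≤ T) →
      (∀ t ∈ W, ∀ t' ∈ W, t ≠ t' → 1 ≤ |t - t'|) →
      (∀ t ∈ W, (N : ℝ) ^ σ ≤ ‖∑ n ∈ Finset.Icc N (2 * N), b n * (n : ℂ) ^ ((t : ℂ) * I)‖) →
      (W.card : ℝ) ≤ C * T ^ ε * ((N : ℝ) ^ (2 - 2 * σ) + (N : ℝ) ^ (5 - 6 * σ) +
        T ^ ((k : ℝ) / ((k : ℝ) + 1)) * (N : ℝ) ^ ((4 - 6 * σ) * ((k : ℝ) / ((k : ℝ) + 1))) +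
        (N : ℝ) ^ ((5 - 6 * σ) * (4 * (k : ℝ) / (4 * (k : ℝ) + 3))) * T ^ (2 / (4 * (k : ℝ) + 3)) +
        T ^ (4 / 3 : ℝ) * (N : ℝ) ^ (2 - 4 * σ) + T ^ (1 / 2 : ℝ) * (N : ℝ) ^ (3 - 4 * σ) +
        T * (N : ℝ) ^ (9 / 2 - 7 * σ) + T ^ (18 / 19 : ℝ) * (N : ℝ) ^ ((72 - 112 * σ) / 19)) := by
  intro ε hε
  classical
  -- ### parameters
  set ε' : ℝ := min ε 1 with hε'
  have hε'0 : 0 < ε' := lt_min hε one_pos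
  have hε'ε : ε' ≤ ε := min_le_left _ _
  have hε'1 : ε' ≤ 1 := min_le_right _ _
  set η : ℝ := ε' / 3 with hη
  have hη0 : 0 < η := by positivity
  have hη1 : η ≤ 1 := by linarith
  obtain ⟨C_F, T_F, hCF0, hF⟩ := hFB η hη0 η hη0
  set K : ℝ := 1679616 with hK
  have hk0 : (0 : ℝ) ≤ k := Nat.cast_nonneg k
  refine ⟨54 * K * C_F, max (max T_F 0) ((2 : ℝ) ^ 60), by positivity,
    fun T hT N σ b W hN56 hNT hb hW hsep hlarge ↦ ?_⟩
  -- ### basic facts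
  have hTF : T_F ≤ T := le_trans ((le_max_left _ _).trans (le_max_left _ _)) hT
  have hT60 : (2 : ℝ) ^ 60 ≤ T := le_trans (le_max_right _ _) hT
  have hT1 : (1 : ℝ) ≤ T := le_trans (by norm_num) hT60
  have hT0 : 0 < T := by linarith
  have hT34_1 : 1 ≤ T ^ (3 / 4 : ℝ) := Real.one_le_rpow hT1 (by norm_num)
  -- `T^{1/12} ≥ 32`, so `T^{5/6} ≥ 32 T^{3/4}` and `N ≥ 32 T^{3/4} ≥ 32`
  have hT12 : 32 ≤ T ^ (1 / 12 : ℝ) := by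
    have h1 : ((2 : ℝ) ^ 60) ^ (1 / 12 : ℝ) ≤ T ^ (1 / 12 : ℝ) :=
      Real.rpow_le_rpow (by positivity) hT60 (by norm_num)
    have h2 : ((2 : ℝ) ^ 60) ^ (1 / 12 : ℝ) = 32 := by
      rw [show (2 : ℝ) ^ 60 = (32 : ℝ) ^ (12 : ℕ) by norm_num,
        show (1 / 12 : ℝ) = ((12 : ℕ) : ℝ)⁻¹ by norm_num,
        Real.pow_rpow_inv_natCast (by norm_num) (by norm_num)]
    linarith
  have hT56 : 32 * T ^ (3 / 4 : ℝ) ≤ T ^ (5 / 6 : ℝ) := by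
    have e : T ^ (5 / 6 : ℝ) = T ^ (3 / 4 : ℝ) * T ^ (1 / 12 : ℝ) := by
      rw [← Real.rpow_add hT0]; norm_num
    rw [e]
    have h0 : 0 ≤ T ^ (3 / 4 : ℝ) := by positivity
    nlinarith [mul_le_mul_of_nonneg_left hT12 h0]
  have hN32T : 32 * T ^ (3 / 4 : ℝ) ≤ N := hT56.trans hN56
  have hN32 : (32 : ℝ) ≤ N := by nlinarith
  have hN10 : 10 ≤ N := by exact_mod_cast (show (10 : ℝ) ≤ N by linarith)
  have hN0 : (0 : ℝ) < N := by linarith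
  have hN1 : 1 ≤ N := by omega
  have h2T34 : (2 * T) ^ (3 / 4 : ℝ) ≤ 2 * T ^ (3 / 4 : ℝ) := by
    rw [Real.mul_rpow (by norm_num) hT0.le]
    refine mul_le_mul_of_nonneg_right ?_ (by positivity)
    calc (2 : ℝ) ^ (3 / 4 : ℝ) ≤ (2 : ℝ) ^ (1 : ℝ) :=
          Real.rpow_le_rpow_of_exponent_le (by norm_num) (by norm_num)
      _ = 2 := Real.rpow_one _
  have h2Tη : (2 * T) ^ η ≤ 2 * T ^ η := by
    rw [Real.mul_rpow (by norm_num) hT0.le]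
    refine mul_le_mul_of_nonneg_right ?_ (by positivity)
    calc (2 : ℝ) ^ η ≤ (2 : ℝ) ^ (1 : ℝ) := Real.rpow_le_rpow_of_exponent_le (by norm_num) hη1
      _ = 2 := Real.rpow_one _
  have hTηη : T ^ η * T ^ η ≤ T ^ ε' := by
    rw [← Real.rpow_add hT0]
    exact Real.rpow_le_rpow_of_exponent_le hT1 (by rw [hη]; linarith)
  have hTε : T ^ ε' ≤ T ^ ε := Real.rpow_le_rpow_of_exponent_le hT1 hε'ε
  set V : ℝ := (N : ℝ) ^ σ with hV
  have hV0 : 0 < V := by positivity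
  -- the eight-term right-hand side at `(N, T, σ)`
  set R : ℝ := (N : ℝ) ^ (2 - 2 * σ) + (N : ℝ) ^ (5 - 6 * σ) +
        T ^ ((k : ℝ) / ((k : ℝ) + 1)) * (N : ℝ) ^ ((4 - 6 * σ) * ((k : ℝ) / ((k : ℝ) + 1))) +
        (N : ℝ) ^ ((5 - 6 * σ) * (4 * (k : ℝ) / (4 * (k : ℝ) + 3))) * T ^ (2 / (4 * (k : ℝ) + 3)) +
        T ^ (4 / 3 : ℝ) * (N : ℝ) ^ (2 - 4 * σ) + T ^ (1 / 2 : ℝ) * (N : ℝ) ^ (3 - 4 * σ) +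
        T * (N : ℝ) ^ (9 / 2 - 7 * σ) + T ^ (18 / 19 : ℝ) * (N : ℝ) ^ ((72 - 112 * σ) / 19) with hR
  have hR0 : 0 ≤ R := by positivity
  -- exponent ranges used in the term conversion
  have hk1' : (k : ℝ) / ((k : ℝ) + 1) ≤ 1 := by
    rw [div_le_one (by positivity)]; linarith
  have hk1'0 : 0 ≤ (k : ℝ) / ((k : ℝ) + 1) := by positivity
  have hk4' : 4 * (k : ℝ) / (4 * (k : ℝ) + 3) ≤ 1 := by
    rw [div_le_one (by positivity)]; linarith
  have hk4'0 : 0 ≤ 4 * (k : ℝ) / (4 * (k : ℝ) + 3) := by positivity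
  have hk2' : 2 / (4 * (k : ℝ) + 3) ≤ 2 := by
    rw [div_le_iff₀ (by positivity)]; linarith
  have hk2'0 : 0 ≤ 2 / (4 * (k : ℝ) + 3) := by positivity
  -- ### the generic piece
  have hpiece : ∀ (P : Finset ℕ) (N' : ℕ), (∀ n ∈ P, 6 * N' ≤ 5 * n ∧ 5 * n ≤ 9 * N') →
      2 * N ≤ 3 * N' + 3 → 5 * N' ≤ 6 * N →
      ((W.filter (fun t : ℝ ↦ V / 3 ≤ ‖∑ n ∈ P, b n * (n : ℂ) ^ ((t : ℂ) * I)‖)).card : ℝ) ≤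
        18 * K * C_F * T ^ ε' * R := by
    intro P N' hP h23 h56
    have h23r : 2 * (N : ℝ) ≤ 3 * N' + 3 := by exact_mod_cast h23
    have h56r : 5 * (N' : ℝ) ≤ 6 * N := by exact_mod_cast h56
    have hN'6 : 6 ≤ N' := by omega
    have hN'1 : 1 ≤ N' := by omega
    have hN'0 : (0 : ℝ) < N' := by exact_mod_cast (by omega : 0 < N')
    have hN'1r : (1 : ℝ) < N' := by exact_mod_cast (by omega : 1 < N')
    have hN'2N : (N' : ℝ) ≤ 2 * N := by linarith
    have hN'T : (N' : ℝ) ≤ 2 * T := by linarith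
    have hN'low : (2 * T) ^ (3 / 4 : ℝ) ≤ N' := by linarith
    -- `σ'` with `N'^{σ'} = V/3`
    have hV3 : 0 < V / 3 := by positivity
    set σ' : ℝ := Real.logb N' (V / 3) with hσ'
    have hNσ' : (N' : ℝ) ^ σ' = V / 3 := by
      rw [hσ']; exact Real.rpow_logb hN'0 hN'1r.ne' hV3
    have hVeq : (N' : ℝ) ^ σ' = (N : ℝ) ^ σ / 3 := by rw [hNσ', hV]
    -- the modified coefficients
    set a : ℕ → ℂ := fun n ↦ if n ∈ P then b n else 0 with ha
    have ha1 : ∀ n, ‖a n‖ ≤ 1 := by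
      intro n; rw [ha]; dsimp only
      split_ifs
      · exact hb n
      · simp
    have hTF' : T_F ≤ 2 * T := by linarith
    have h2T0 : (0 : ℝ) < 2 * T := by positivity
    set S : ℝ := (2 * T) ^ η with hSdef
    have hS1 : 1 ≤ S := Real.one_le_rpow (by linarith) hη0.le
    -- the eight terms at `(N', 2T, σ')`
    set R' : ℝ := (N' : ℝ) ^ (2 - 2 * σ') + (N' : ℝ) ^ (5 - 6 * σ') +
        (2 * T) ^ ((k : ℝ) / ((k : ℝ) + 1)) * (N' : ℝ) ^ ((4 - 6 * σ') * ((k : ℝ) / ((k : ℝ) + 1))) +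
        (N' : ℝ) ^ ((5 - 6 * σ') * (4 * (k : ℝ) / (4 * (k : ℝ) + 3))) *
          (2 * T) ^ (2 / (4 * (k : ℝ) + 3)) +
        (2 * T) ^ (4 / 3 : ℝ) * (N' : ℝ) ^ (2 - 4 * σ') + (2 * T) ^ (1 / 2 : ℝ) * (N' : ℝ) ^ (3 - 4 * σ') +
        2 * T * (N' : ℝ) ^ (9 / 2 - 7 * σ') +
        (2 * T) ^ (18 / 19 : ℝ) * (N' : ℝ) ^ ((72 - 112 * σ') / 19) with hR'
    have hR'0 : 0 ≤ R' := by positivity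
    set B : ℝ := C_F * (2 * T) ^ η * R' with hB
    have hB0 : 0 ≤ B := by positivity
    -- the filtered set
    set WP := W.filter (fun t : ℝ ↦ V / 3 ≤ ‖∑ n ∈ P, b n * (n : ℂ) ^ ((t : ℂ) * I)‖) with hWPdef
    have hWPmem : ∀ t ∈ WP, 0 ≤ t ∧ t ≤ T := fun t ht ↦ by
      rw [hWPdef, Finset.mem_filter] at ht; exact hW t ht.1
    have hsepP : ∀ t ∈ WP, ∀ t' ∈ WP, t ≠ t' → 1 ≤ |t - t'| := fun t ht t' ht' hne ↦ by
      rw [hWPdef, Finset.mem_filter] at ht ht'; exact hsep t ht.1 t' ht'.1 hne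
    have hlargeP : ∀ t ∈ WP, V / 3 ≤ ‖∑ n ∈ P, b n * (n : ℂ) ^ ((t : ℂ) * I)‖ := fun t ht ↦ by
      rw [hWPdef, Finset.mem_filter] at ht; exact ht.2
    -- (12.1) on an `S`-separated subset in a window of length `2T`
    have hshort : ∀ (t₀ : ℝ), ∀ W' ⊆ WP, (∀ t ∈ W', t₀ ≤ t ∧ t ≤ t₀ + 2 * T) →
        (∀ t ∈ W', ∀ t' ∈ W', t ≠ t' → S ≤ |t - t'|) → (W'.card : ℝ) ≤ B := by
      intro t₀ W' hW'W hI hsepS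
      refine hF (2 * T) hTF' N' hN'low hN'T σ' a t₀ W' ha1 hI hsepS ?_
      intro t ht
      have e : ∑ n ∈ Finset.Icc N' (2 * N'), ((w ((n : ℝ) / N') : ℝ) : ℂ) * a n *
          (n : ℂ) ^ ((t : ℂ) * I) = ∑ n ∈ P, b n * (n : ℂ) ^ ((t : ℂ) * I) := by
        rw [ha]; exact GuthMaynardReduction.sum_weight_indicator_eq hw hN'1 P hP b t
      rw [e, hNσ']
      exact hlargeP t (hW'W ht)
    have hcount := GuthMaynardReduction.card_le_of_sep_of_short hT0.le h2T0 hS1 hB0 WP hWPmem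
      hsepP hshort
    have hTT : T / (2 * T) + 1 = 3 / 2 := by field_simp; ring
    rw [hTT] at hcount
    -- ### the term conversion `R' ≤ K R`
    have c1 : (N' : ℝ) ^ (2 - 2 * σ') ≤ K * (N : ℝ) ^ (2 - 2 * σ) := by
      have h := term_le (a := 0) (b := 2) (c := 2) hT1 h2T0.le le_rfl hN0 hN'0 hN'2N hVeq
        le_rfl (by norm_num) (by norm_num) (by norm_num) (by norm_num)
      simpa only [Real.rpow_zero, one_mul] using h
    have c2 : (N' : ℝ) ^ (5 - 6 * σ') ≤ K * (N : ℝ) ^ (5 - 6 * σ) := by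
      have h := term_le (a := 0) (b := 5) (c := 6) hT1 h2T0.le le_rfl hN0 hN'0 hN'2N hVeq
        le_rfl (by norm_num) (by norm_num) (by norm_num) (by norm_num)
      simpa only [Real.rpow_zero, one_mul] using h
    have c3 : (2 * T) ^ ((k : ℝ) / ((k : ℝ) + 1)) * (N' : ℝ) ^ ((4 - 6 * σ') * ((k : ℝ) / ((k : ℝ) + 1))) ≤
        K * (T ^ ((k : ℝ) / ((k : ℝ) + 1)) * (N : ℝ) ^ ((4 - 6 * σ) * ((k : ℝ) / ((k : ℝ) + 1)))) := by
      rw [show (4 - 6 * σ') * ((k : ℝ) / ((k : ℝ) + 1)) =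
          4 * ((k : ℝ) / ((k : ℝ) + 1)) - 6 * ((k : ℝ) / ((k : ℝ) + 1)) * σ' by ring,
        show (4 - 6 * σ) * ((k : ℝ) / ((k : ℝ) + 1)) =
          4 * ((k : ℝ) / ((k : ℝ) + 1)) - 6 * ((k : ℝ) / ((k : ℝ) + 1)) * σ by ring]
      exact term_le hT1 h2T0.le le_rfl hN0 hN'0 hN'2N hVeq hk1'0 (by linarith) (by positivity)
        (by linarith) (by linarith)
    have c4 : (N' : ℝ) ^ ((5 - 6 * σ') * (4 * (k : ℝ) / (4 * (k : ℝ) + 3))) *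
          (2 * T) ^ (2 / (4 * (k : ℝ) + 3)) ≤
        K * ((N : ℝ) ^ ((5 - 6 * σ) * (4 * (k : ℝ) / (4 * (k : ℝ) + 3))) *
          T ^ (2 / (4 * (k : ℝ) + 3))) := by
      rw [mul_comm ((N' : ℝ) ^ _), mul_comm ((N : ℝ) ^ _),
        show (5 - 6 * σ') * (4 * (k : ℝ) / (4 * (k : ℝ) + 3)) =
          5 * (4 * (k : ℝ) / (4 * (k : ℝ) + 3)) - 6 * (4 * (k : ℝ) / (4 * (k : ℝ) + 3)) * σ' by ring,
        show (5 - 6 * σ) * (4 * (k : ℝ) / (4 * (k : ℝ) + 3)) =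
          5 * (4 * (k : ℝ) / (4 * (k : ℝ) + 3)) - 6 * (4 * (k : ℝ) / (4 * (k : ℝ) + 3)) * σ by ring]
      exact term_le hT1 h2T0.le le_rfl hN0 hN'0 hN'2N hVeq hk2'0 hk2' (by positivity)
        (by linarith) (by linarith)
    have c5 : (2 * T) ^ (4 / 3 : ℝ) * (N' : ℝ) ^ (2 - 4 * σ') ≤
        K * (T ^ (4 / 3 : ℝ) * (N : ℝ) ^ (2 - 4 * σ)) :=
      term_le (b := 2) (c := 4) hT1 h2T0.le le_rfl hN0 hN'0 hN'2N hVeq (by norm_num) (by norm_num)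
        (by norm_num) (by norm_num) (by norm_num)
    have c6 : (2 * T) ^ (1 / 2 : ℝ) * (N' : ℝ) ^ (3 - 4 * σ') ≤
        K * (T ^ (1 / 2 : ℝ) * (N : ℝ) ^ (3 - 4 * σ)) :=
      term_le (b := 3) (c := 4) hT1 h2T0.le le_rfl hN0 hN'0 hN'2N hVeq (by norm_num) (by norm_num)
        (by norm_num) (by norm_num) (by norm_num)
    have c7 : 2 * T * (N' : ℝ) ^ (9 / 2 - 7 * σ') ≤ K * (T * (N : ℝ) ^ (9 / 2 - 7 * σ)) := by
      have h := term_le (a := 1) (b := 9 / 2) (c := 7) hT1 h2T0.le le_rfl hN0 hN'0 hN'2N hVeq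
        (by norm_num) (by norm_num) (by norm_num) (by norm_num) (by norm_num)
      simpa only [Real.rpow_one] using h
    have c8 : (2 * T) ^ (18 / 19 : ℝ) * (N' : ℝ) ^ ((72 - 112 * σ') / 19) ≤
        K * (T ^ (18 / 19 : ℝ) * (N : ℝ) ^ ((72 - 112 * σ) / 19)) := by
      rw [show (72 - 112 * σ') / 19 = 72 / 19 - 112 / 19 * σ' by ring,
        show (72 - 112 * σ) / 19 = 72 / 19 - 112 / 19 * σ by ring]
      exact term_le hT1 h2T0.le le_rfl hN0 hN'0 hN'2N hVeq (by norm_num) (by norm_num)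
        (by norm_num) (by norm_num) (by norm_num)
    have hconv : R' ≤ K * R := by
      rw [hR', hR]
      linarith [c1, c2, c3, c4, c5, c6, c7, c8]
    -- ### collecting
    have hS2 : S + 2 ≤ 3 * S := by linarith
    have hSle : S ≤ 2 * T ^ η := h2Tη
    calc (WP.card : ℝ) ≤ (S + 2) * (3 / 2 * B) := hcount
      _ ≤ (3 * S) * (3 / 2 * B) := by gcongr
      _ = 9 / 2 * S * (C_F * (2 * T) ^ η * R') := by rw [hB]; ring
      _ ≤ 9 / 2 * (2 * T ^ η) * (C_F * (2 * T ^ η) * (K * R)) := by gcongr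
      _ = 18 * K * C_F * (T ^ η * T ^ η) * R := by ring
      _ ≤ 18 * K * C_F * T ^ ε' * R := by gcongr
  -- ### the three pieces and their parameters
  set P₁ := (Finset.Icc N (2 * N)).filter (fun n ↦ 5 * n < 6 * N) with hP₁
  set P₂ := (Finset.Icc N (2 * N)).filter (fun n ↦ 6 * N ≤ 5 * n ∧ 5 * n ≤ 9 * N) with hP₂
  set P₃ := (Finset.Icc N (2 * N)).filter (fun n ↦ 9 * N < 5 * n) with hP₃
  have hP₁' : ∀ n ∈ P₁, 6 * (5 * N / 6) ≤ 5 * n ∧ 5 * n ≤ 9 * (5 * N / 6) := by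
    intro n hn
    rw [hP₁, Finset.mem_filter, Finset.mem_Icc] at hn
    omega
  have hP₂' : ∀ n ∈ P₂, 6 * N ≤ 5 * n ∧ 5 * n ≤ 9 * N := by
    intro n hn
    rw [hP₂, Finset.mem_filter, Finset.mem_Icc] at hn
    omega
  have hP₃' : ∀ n ∈ P₃, 6 * ((10 * N + 8) / 9) ≤ 5 * n ∧ 5 * n ≤ 9 * ((10 * N + 8) / 9) := by
    intro n hn
    rw [hP₃, Finset.mem_filter, Finset.mem_Icc] at hn
    omega
  have h1 := hpiece P₁ (5 * N / 6) hP₁' (by omega) (by omega)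
  have h2 := hpiece P₂ N hP₂' (by omega) (by omega)
  have h3 := hpiece P₃ ((10 * N + 8) / 9) hP₃' (by omega) (by omega)
  -- the cover
  set W₁ := W.filter (fun t : ℝ ↦ V / 3 ≤ ‖∑ n ∈ P₁, b n * (n : ℂ) ^ ((t : ℂ) * I)‖) with hW₁
  set W₂ := W.filter (fun t : ℝ ↦ V / 3 ≤ ‖∑ n ∈ P₂, b n * (n : ℂ) ^ ((t : ℂ) * I)‖) with hW₂
  set W₃ := W.filter (fun t : ℝ ↦ V / 3 ≤ ‖∑ n ∈ P₃, b n * (n : ℂ) ^ ((t : ℂ) * I)‖) with hW₃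
  have hcover : W ⊆ W₁ ∪ W₂ ∪ W₃ := by
    intro t ht
    have hsplit := GuthMaynardReduction.norm_sum_Icc_le_three_pieces N
      (fun n ↦ b n * (n : ℂ) ^ ((t : ℂ) * I))
    rw [← hP₁, ← hP₂, ← hP₃] at hsplit
    have hVt := hlarge t ht
    rw [Finset.mem_union, Finset.mem_union, hW₁, hW₂, hW₃, Finset.mem_filter, Finset.mem_filter,
      Finset.mem_filter]
    by_contra hcon
    push Not at hcon
    obtain ⟨⟨h1', h2'⟩, h3'⟩ := hcon
    have := h1' ht; have := h2' ht; have := h3' ht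
    linarith
  have htot : (W.card : ℝ) ≤ W₁.card + W₂.card + W₃.card := by
    have := (Finset.card_le_card hcover).trans
      ((Finset.card_union_le _ _).trans (Nat.add_le_add_right (Finset.card_union_le _ _) _))
    exact_mod_cast this
  have hCR : 0 ≤ 18 * K * C_F * R := by positivity
  calc (W.card : ℝ) ≤ W₁.card + W₂.card + W₃.card := htot
    _ ≤ 18 * K * C_F * T ^ ε' * R + 18 * K * C_F * T ^ ε' * R + 18 * K * C_F * T ^ ε' * R :=
        add_le_add (add_le_add h1 h2) h3
    _ = (18 * K * C_F * R) * T ^ ε' * 3 := by ring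
    _ ≤ (18 * K * C_F * R) * T ^ ε * 3 := by gcongr
    _ = 54 * K * C_F * T ^ ε * R := by ring

/-! ## The first display of Proposition 12.1 for a fixed `k` -/

/-- **The "little algebra" of the proof of Proposition 12.1**: for `σ ≥ 7/10`, `n, T ≥ 1` and
`T^{5/6} ≤ n` (so `T ≤ n^{6/5}`), the 5th, 7th and 8th terms of (12.1) are dominated by the 6th:
`T^{4/3}n^{2−4σ}, Tn^{9/2−7σ}, T^{18/19}n^{(72−112σ)/19} ≤ T^{1/2}n^{3−4σ}` ("Therefore the
`T^{1/2}N^{3−4σ}` term in (12.1) dominates the 5th, 7th and 8th terms"); private plumbing.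
[cite: GuthMaynard2026, Section 12, proof of Proposition 12.1] -/
private lemma terms_578_le {n T σ : ℝ} (hn : 1 ≤ n) (hT : 1 ≤ T) (hTn : T ^ (5 / 6 : ℝ) ≤ n)
    (hσ : 7 / 10 ≤ σ) :
    T ^ (4 / 3 : ℝ) * n ^ (2 - 4 * σ) ≤ T ^ (1 / 2 : ℝ) * n ^ (3 - 4 * σ) ∧
    T * n ^ (9 / 2 - 7 * σ) ≤ T ^ (1 / 2 : ℝ) * n ^ (3 - 4 * σ) ∧
    T ^ (18 / 19 : ℝ) * n ^ ((72 - 112 * σ) / 19) ≤ T ^ (1 / 2 : ℝ) * n ^ (3 - 4 * σ) := by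
  have hn0 : 0 < n := by linarith
  have hT0 : 0 < T := by linarith
  have hpow : ∀ a b : ℝ, a ≤ b → n ^ a ≤ n ^ b := fun a b hab ↦
    Real.rpow_le_rpow_of_exponent_le hn hab
  -- `T ≤ n^{6/5}`
  have hT65 : T ≤ n ^ (6 / 5 : ℝ) := by
    have e : (T ^ (5 / 6 : ℝ)) ^ (6 / 5 : ℝ) = T := by rw [← Real.rpow_mul hT0.le]; norm_num
    rw [← e]; exact Real.rpow_le_rpow (by positivity) hTn (by norm_num)
  have hTa : ∀ a : ℝ, 0 ≤ a → T ^ a ≤ n ^ (6 / 5 * a) := fun a ha ↦ by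
    rw [Real.rpow_mul hn0.le]; exact Real.rpow_le_rpow hT0.le hT65 ha
  have h12 : 0 ≤ T ^ (1 / 2 : ℝ) := by positivity
  refine ⟨?_, ?_, ?_⟩
  · -- `T^{4/3} = T^{1/2} T^{5/6}`, `T^{5/6} n^{2−4σ} ≤ n · n^{2−4σ} = n^{3−4σ}`
    have e1 : T ^ (4 / 3 : ℝ) = T ^ (1 / 2 : ℝ) * T ^ (5 / 6 : ℝ) := by
      rw [← Real.rpow_add hT0]; norm_num
    have e2 : n ^ (3 - 4 * σ) = n ^ (1 : ℝ) * n ^ (2 - 4 * σ) := by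
      rw [← Real.rpow_add hn0]; ring_nf
    rw [e1, e2, Real.rpow_one, mul_assoc]
    exact mul_le_mul_of_nonneg_left (mul_le_mul_of_nonneg_right hTn (by positivity)) h12
  · -- `T = T^{1/2} T^{1/2}`, `T^{1/2} ≤ n^{3/5} ≤ n^{3σ − 3/2}`
    have h1 : T ^ (1 / 2 : ℝ) ≤ n ^ (3 * σ - 3 / 2) :=
      (hTa _ (by norm_num)).trans (hpow _ _ (by linarith))
    calc T * n ^ (9 / 2 - 7 * σ) = T ^ (1 / 2 : ℝ) * (T ^ (1 / 2 : ℝ) * n ^ (9 / 2 - 7 * σ)) := by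
          rw [← mul_assoc, ← Real.rpow_add hT0]; norm_num
      _ ≤ T ^ (1 / 2 : ℝ) * (n ^ (3 * σ - 3 / 2) * n ^ (9 / 2 - 7 * σ)) :=
          mul_le_mul_of_nonneg_left (mul_le_mul_of_nonneg_right h1 (by positivity)) h12
      _ = T ^ (1 / 2 : ℝ) * n ^ (3 - 4 * σ) := by
          rw [← Real.rpow_add hn0]; ring_nf
  · -- `T^{18/19} = T^{1/2} T^{17/38}`, `T^{17/38} ≤ n^{51/95} ≤ n^{(36σ−15)/19}`
    have e1 : T ^ (18 / 19 : ℝ) = T ^ (1 / 2 : ℝ) * T ^ (17 / 38 : ℝ) := by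
      rw [← Real.rpow_add hT0]; norm_num
    have h1 : T ^ (17 / 38 : ℝ) ≤ n ^ ((36 * σ - 15) / 19) :=
      (hTa _ (by norm_num)).trans (hpow _ _ (by linarith))
    have e2 : n ^ (3 - 4 * σ) = n ^ ((36 * σ - 15) / 19) * n ^ ((72 - 112 * σ) / 19) := by
      rw [← Real.rpow_add hn0]; ring_nf
    rw [e1, e2, mul_assoc]
    exact mul_le_mul_of_nonneg_left (mul_le_mul_of_nonneg_right h1 (by positivity)) h12

/-- `min(TN^{1−2σ}, N^{5−6σ}) ≤ T^{1/2}N^{3−4σ}`, in the form: if `T^{1/2}n^{3−4σ} < n^{5−6σ}` then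
`T n^{1−2σ} ≤ T^{1/2} n^{3−4σ}` ("We also have `T^{1/2}N^{3−4σ} ≫ min(TN^{1−2σ}, N^{5−6σ})`");
private plumbing. [cite: GuthMaynard2026, Section 12, proof of Proposition 12.1] -/
private lemma mvt_term_le {n T σ : ℝ} (hn : 0 < n) (hT : 0 < T)
    (h : T ^ (1 / 2 : ℝ) * n ^ (3 - 4 * σ) < n ^ (5 - 6 * σ)) :
    T * n ^ (1 - 2 * σ) ≤ T ^ (1 / 2 : ℝ) * n ^ (3 - 4 * σ) := by
  -- `n^{5−6σ} = n^{2−2σ} n^{3−4σ}` so `T^{1/2} < n^{2−2σ}`; and `T n^{1−2σ} = T^{1/2} (T^{1/2} n^{1−2σ})`,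
  -- `n^{3−4σ} = n^{2−2σ} n^{1−2σ}`.
  have e1 : n ^ (5 - 6 * σ) = n ^ (2 - 2 * σ) * n ^ (3 - 4 * σ) := by
    rw [← Real.rpow_add hn]; ring_nf
  have h34 : 0 < n ^ (3 - 4 * σ) := by positivity
  have h1 : T ^ (1 / 2 : ℝ) < n ^ (2 - 2 * σ) := by
    rw [e1] at h
    by_contra hc
    push Not at hc
    have := mul_le_mul_of_nonneg_right hc h34.le
    linarith
  calc T * n ^ (1 - 2 * σ) = T ^ (1 / 2 : ℝ) * (T ^ (1 / 2 : ℝ) * n ^ (1 - 2 * σ)) := by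
        rw [← mul_assoc, ← Real.rpow_add hT]; norm_num
    _ ≤ T ^ (1 / 2 : ℝ) * (n ^ (2 - 2 * σ) * n ^ (1 - 2 * σ)) :=
        mul_le_mul_of_nonneg_left (mul_le_mul_of_nonneg_right h1.le (by positivity)) (by positivity)
    _ = T ^ (1 / 2 : ℝ) * n ^ (3 - 4 * σ) := by
        rw [← Real.rpow_add hn]; ring_nf

set_option maxHeartbeats 1600000 in
/-- **The first display of Proposition 12.1 for a fixed `k`, from (12.1).** If the eight-term bound
(12.1) holds for unweighted Dirichlet polynomials on `1`-separated `W ⊂ [0,T]` with `T^{5/6} ≤ N ≤ T`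
(hypothesis `h8`, the conclusion of `largeValues_of_fullBound` for this `k`), then for `σ ≥ 7/10`:
`|W| ≤ C T^ε (N^{2−2σ} + T^{1/2}N^{3−4σ} + T^{k/(k+1)}N^{(4−6σ)k/(k+1)} + N^{(5−6σ)4k/(4k+3)}T^{2/(4k+3)})`
— "The bound now follows from (12.1), (1.1) and a little algebra": the 5th, 7th, 8th terms of (12.1)
are dominated by `T^{1/2}N^{3−4σ}` (`terms_578_le`), and the 2nd term `N^{5−6σ}` is either
`≤ T^{1/2}N^{3−4σ}` or else the mean value estimate (1.1) (`GuthMaynardLargeValues.largeValues_mvt_logFree`: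
`|W| ≪ (N² + TN)N^{−2σ} ≪ TN^{1−2σ}`) gives `|W| ≪ T^{1/2}N^{3−4σ}` (`mvt_term_le`). The constant
is `5C₈ + 176` with `C₈` that of `h8`. [cite: GuthMaynard2026, Section 12, proof of Proposition 12.1] -/
theorem inf_bound_fixed_k {k : ℕ}
    (h8 : ∀ ε : ℝ, 0 < ε → ∃ C T₀ : ℝ, 0 ≤ C ∧ ∀ T : ℝ, T₀ ≤ T →
      ∀ (N : ℕ) (σ : ℝ) (b : ℕ → ℂ) (W : Finset ℝ), T ^ (5 / 6 : ℝ) ≤ (N : ℝ) → (N : ℝ) ≤ T →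
      (∀ n, ‖b n‖ ≤ 1) → (∀ t ∈ W, 0 ≤ t ∧ t ≤ T) →
      (∀ t ∈ W, ∀ t' ∈ W, t ≠ t' → 1 ≤ |t - t'|) →
      (∀ t ∈ W, (N : ℝ) ^ σ ≤ ‖∑ n ∈ Finset.Icc N (2 * N), b n * (n : ℂ) ^ ((t : ℂ) * I)‖) →
      (W.card : ℝ) ≤ C * T ^ ε * ((N : ℝ) ^ (2 - 2 * σ) + (N : ℝ) ^ (5 - 6 * σ) +
        T ^ ((k : ℝ) / ((k : ℝ) + 1)) * (N : ℝ) ^ ((4 - 6 * σ) * ((k : ℝ) / ((k : ℝ) + 1))) +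
        (N : ℝ) ^ ((5 - 6 * σ) * (4 * (k : ℝ) / (4 * (k : ℝ) + 3))) * T ^ (2 / (4 * (k : ℝ) + 3)) +
        T ^ (4 / 3 : ℝ) * (N : ℝ) ^ (2 - 4 * σ) + T ^ (1 / 2 : ℝ) * (N : ℝ) ^ (3 - 4 * σ) +
        T * (N : ℝ) ^ (9 / 2 - 7 * σ) + T ^ (18 / 19 : ℝ) * (N : ℝ) ^ ((72 - 112 * σ) / 19))) :
    ∀ ε : ℝ, 0 < ε → ∃ C T₀ : ℝ, 0 ≤ C ∧ ∀ T : ℝ, T₀ ≤ T →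
      ∀ (N : ℕ) (σ : ℝ) (b : ℕ → ℂ) (W : Finset ℝ), T ^ (5 / 6 : ℝ) ≤ (N : ℝ) → (N : ℝ) ≤ T →
      7 / 10 ≤ σ → (∀ n, ‖b n‖ ≤ 1) → (∀ t ∈ W, 0 ≤ t ∧ t ≤ T) →
      (∀ t ∈ W, ∀ t' ∈ W, t ≠ t' → 1 ≤ |t - t'|) →
      (∀ t ∈ W, (N : ℝ) ^ σ ≤ ‖∑ n ∈ Finset.Icc N (2 * N), b n * (n : ℂ) ^ ((t : ℂ) * I)‖) →
      (W.card : ℝ) ≤ C * T ^ ε *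
        ((N : ℝ) ^ (2 - 2 * σ) + T ^ (1 / 2 : ℝ) * (N : ℝ) ^ (3 - 4 * σ) +
          (T ^ ((k : ℝ) / (k + 1)) * (N : ℝ) ^ ((4 - 6 * σ) * (k / (k + 1 : ℝ))) +
            (N : ℝ) ^ ((5 - 6 * σ) * (4 * k / (4 * k + 3 : ℝ))) * T ^ (2 / (4 * k + 3 : ℝ)))) := by
  intro ε hε
  obtain ⟨C₈, T₈, hC₈0, h⟩ := h8 ε hε
  refine ⟨5 * C₈ + 176, max T₈ 1, by positivity,
    fun T hT N σ b W hN56 hNT hσ hb hW hsep hlarge ↦ ?_⟩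
  have hT8 : T₈ ≤ T := le_trans (le_max_left _ _) hT
  have hT1 : (1 : ℝ) ≤ T := le_trans (le_max_right _ _) hT
  have hT0 : 0 < T := by linarith
  have hN1r : (1 : ℝ) ≤ N := (Real.one_le_rpow hT1 (by norm_num)).trans hN56
  have hN1 : 1 ≤ N := by exact_mod_cast hN1r
  have hN0 : (0 : ℝ) < N := by linarith
  set n : ℝ := (N : ℝ) with hn
  have hTε1 : 1 ≤ T ^ ε := Real.one_le_rpow hT1 hε.le
  -- the four kept terms
  have ht1 : 0 ≤ n ^ (2 - 2 * σ) := by positivity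
  have ht3 : 0 ≤ T ^ ((k : ℝ) / ((k : ℝ) + 1)) * n ^ ((4 - 6 * σ) * ((k : ℝ) / ((k : ℝ) + 1))) := by
    positivity
  have ht4 : 0 ≤ n ^ ((5 - 6 * σ) * (4 * (k : ℝ) / (4 * (k : ℝ) + 3))) * T ^ (2 / (4 * (k : ℝ) + 3)) := by
    positivity
  have ht6 : 0 ≤ T ^ (1 / 2 : ℝ) * n ^ (3 - 4 * σ) := by positivity
  obtain ⟨h5, h7, h8'⟩ := terms_578_le hN1r hT1 hN56 hσ
  rcases le_or_gt (n ^ (5 - 6 * σ)) (T ^ (1 / 2 : ℝ) * n ^ (3 - 4 * σ)) with h2 | h2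
  · -- (12.1): the 2nd, 5th, 7th, 8th terms are dominated by the 6th
    have hmain := h T hT8 N σ b W hN56 hNT hb hW hsep hlarge
    have hTε0 : 0 ≤ C₈ * T ^ ε := by positivity
    calc (W.card : ℝ) ≤ _ := hmain
      _ ≤ C₈ * T ^ ε * (5 * (n ^ (2 - 2 * σ) + T ^ (1 / 2 : ℝ) * n ^ (3 - 4 * σ) +
          (T ^ ((k : ℝ) / ((k : ℝ) + 1)) * n ^ ((4 - 6 * σ) * ((k : ℝ) / ((k : ℝ) + 1))) +
            n ^ ((5 - 6 * σ) * (4 * (k : ℝ) / (4 * (k : ℝ) + 3))) * T ^ (2 / (4 * (k : ℝ) + 3))))) := by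
          refine mul_le_mul_of_nonneg_left ?_ hTε0
          linarith
      _ = (5 * C₈) * T ^ ε * (n ^ (2 - 2 * σ) + T ^ (1 / 2 : ℝ) * n ^ (3 - 4 * σ) +
          (T ^ ((k : ℝ) / ((k : ℝ) + 1)) * n ^ ((4 - 6 * σ) * ((k : ℝ) / ((k : ℝ) + 1))) +
            n ^ ((5 - 6 * σ) * (4 * (k : ℝ) / (4 * (k : ℝ) + 3))) * T ^ (2 / (4 * (k : ℝ) + 3)))) := by
          ring
      _ ≤ (5 * C₈ + 176) * T ^ ε * (n ^ (2 - 2 * σ) + T ^ (1 / 2 : ℝ) * n ^ (3 - 4 * σ) +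
          (T ^ ((k : ℝ) / ((k : ℝ) + 1)) * n ^ ((4 - 6 * σ) * ((k : ℝ) / ((k : ℝ) + 1))) +
            n ^ ((5 - 6 * σ) * (4 * (k : ℝ) / (4 * (k : ℝ) + 3))) * T ^ (2 / (4 * (k : ℝ) + 3)))) := by
          exact mul_le_mul_of_nonneg_right (mul_le_mul_of_nonneg_right (by linarith)
            (by positivity)) (by positivity)
  · -- the mean value theorem (1.1)
    have hV0 : 0 < n ^ σ := by positivity
    have hmvt := GuthMaynardLargeValues.largeValues_mvt_logFree hT1 hN1 hb hV0 W hW hsep hlarge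
    have hle := mvt_term_le hN0 hT0 h2
    -- `V⁻² · 2(N+1)(5T+3+36N) ≤ 176 T n^{1−2σ}`
    have e1 : (n ^ σ)⁻¹ ^ 2 = n ^ (-(2 * σ)) := by
      rw [inv_pow, ← Real.rpow_natCast, ← Real.rpow_mul hN0.le, ← Real.rpow_neg hN0.le]
      congr 1; push_cast; ring
    have e2 : T * n ^ (1 - 2 * σ) = T * n * n ^ (-(2 * σ)) := by
      rw [show (1 - 2 * σ) = 1 + -(2 * σ) by ring, Real.rpow_add hN0, Real.rpow_one]; ring
    have h3 : 2 * ((n + 1) * (5 * T + 3 + 36 * n)) ≤ 176 * (T * n) := by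
      nlinarith [mul_le_mul_of_nonneg_left hNT (show (0:ℝ) ≤ 36 by norm_num)]
    have hW1 : (W.card : ℝ) ≤ 176 * (T * n ^ (1 - 2 * σ)) := by
      calc (W.card : ℝ) ≤ (n ^ σ)⁻¹ ^ 2 * (2 * ((n + 1) * (5 * T + 3 + 36 * n))) := hmvt
        _ ≤ (n ^ σ)⁻¹ ^ 2 * (176 * (T * n)) := mul_le_mul_of_nonneg_left h3 (by positivity)
        _ = 176 * (T * n ^ (1 - 2 * σ)) := by rw [e2, e1]; ring
    calc (W.card : ℝ) ≤ 176 * (T * n ^ (1 - 2 * σ)) := hW1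
      _ ≤ 176 * (T ^ (1 / 2 : ℝ) * n ^ (3 - 4 * σ)) := by gcongr
      _ ≤ 176 * T ^ ε * (n ^ (2 - 2 * σ) + T ^ (1 / 2 : ℝ) * n ^ (3 - 4 * σ) +
          (T ^ ((k : ℝ) / ((k : ℝ) + 1)) * n ^ ((4 - 6 * σ) * ((k : ℝ) / ((k : ℝ) + 1))) +
            n ^ ((5 - 6 * σ) * (4 * (k : ℝ) / (4 * (k : ℝ) + 3))) * T ^ (2 / (4 * (k : ℝ) + 3)))) := by
          have : T ^ (1 / 2 : ℝ) * n ^ (3 - 4 * σ) ≤ T ^ ε * (n ^ (2 - 2 * σ) +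
              T ^ (1 / 2 : ℝ) * n ^ (3 - 4 * σ) +
              (T ^ ((k : ℝ) / ((k : ℝ) + 1)) * n ^ ((4 - 6 * σ) * ((k : ℝ) / ((k : ℝ) + 1))) +
                n ^ ((5 - 6 * σ) * (4 * (k : ℝ) / (4 * (k : ℝ) + 3))) * T ^ (2 / (4 * (k : ℝ) + 3)))) := by
            have h0 : T ^ (1 / 2 : ℝ) * n ^ (3 - 4 * σ) ≤ n ^ (2 - 2 * σ) +
                T ^ (1 / 2 : ℝ) * n ^ (3 - 4 * σ) +
                (T ^ ((k : ℝ) / ((k : ℝ) + 1)) * n ^ ((4 - 6 * σ) * ((k : ℝ) / ((k : ℝ) + 1))) +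
                  n ^ ((5 - 6 * σ) * (4 * (k : ℝ) / (4 * (k : ℝ) + 3))) * T ^ (2 / (4 * (k : ℝ) + 3))) := by
              linarith
            nlinarith [hTε1, h0, ht6]
          linarith
      _ ≤ (5 * C₈ + 176) * T ^ ε * (n ^ (2 - 2 * σ) + T ^ (1 / 2 : ℝ) * n ^ (3 - 4 * σ) +
          (T ^ ((k : ℝ) / ((k : ℝ) + 1)) * n ^ ((4 - 6 * σ) * ((k : ℝ) / ((k : ℝ) + 1))) +
            n ^ ((5 - 6 * σ) * (4 * (k : ℝ) / (4 * (k : ℝ) + 3))) * T ^ (2 / (4 * (k : ℝ) + 3)))) := by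
          exact mul_le_mul_of_nonneg_right (mul_le_mul_of_nonneg_right (by linarith)
            (by positivity)) (by positivity)

/-! ## The constant uniform in `k`: the first display of Proposition 12.1 -/

/-- `|∑_{N ≤ n ≤ 2N} b_n n^{it}| ≤ N + 1` for `|b_n| ≤ 1`, `N ≥ 1`; private plumbing. [folklore] -/
private lemma norm_dirpoly_Icc_le {N : ℕ} (hN : 1 ≤ N) {b : ℕ → ℂ} (hb : ∀ n, ‖b n‖ ≤ 1) (t : ℝ) :
    ‖∑ n ∈ Finset.Icc N (2 * N), b n * (n : ℂ) ^ ((t : ℂ) * I)‖ ≤ (N : ℝ) + 1 := by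
  have h1 : ‖∑ n ∈ Finset.Icc N (2 * N), b n * (n : ℂ) ^ ((t : ℂ) * I)‖ ≤
      ∑ n ∈ Finset.Icc N (2 * N), (1 : ℝ) := by
    refine (norm_sum_le _ _).trans (Finset.sum_le_sum fun n hn ↦ ?_)
    rw [Finset.mem_Icc] at hn
    have hn0 : 0 < n := by omega
    have hre : ((t : ℂ) * I).re = 0 := by simp [Complex.mul_re]
    rw [norm_mul, Complex.norm_natCast_cpow_of_pos hn0, hre, Real.rpow_zero, mul_one]
    exact hb n
  refine h1.trans (le_of_eq ?_)
  rw [Finset.sum_const, Nat.card_Icc, nsmul_eq_mul, mul_one, show 2 * N + 1 - N = N + 1 by omega]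
  push_cast
  ring

/-- From `N^σ ≤ N + 1 ≤ 2N`: `N^{σ−1} ≤ 2`; private plumbing. [folklore] -/
private lemma rpow_sub_one_le_two {n σ : ℝ} (hn : 1 ≤ n) (h : n ^ σ ≤ n + 1) : n ^ (σ - 1) ≤ 2 := by
  have hn0 : 0 < n := by linarith
  rw [Real.rpow_sub_one hn0.ne', div_le_iff₀ hn0]
  linarith

/-- **`k`-capping, third term**: for `k₀ ≤ k` and `N^{σ−1} ≤ 2`,
`T^{k₀/(k₀+1)}N^{(4−6σ)k₀/(k₀+1)} ≤ 4N^{2−2σ} + T^{k/(k+1)}N^{(4−6σ)k/(k+1)}` (with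
`a = TN^{4−6σ}` the term is `a^{k/(k+1)}`: increasing in `k` if `a ≥ 1`, at most `1 ≤ 4N^{2−2σ}`
otherwise); private plumbing. [folklore] -/
private lemma term3_cap {n T σ : ℝ} {k k₀ : ℕ} (hn : 1 ≤ n) (hT : 0 < T) (hk : k₀ ≤ k)
    (hσn : n ^ (σ - 1) ≤ 2) :
    T ^ ((k₀ : ℝ) / ((k₀ : ℝ) + 1)) * n ^ ((4 - 6 * σ) * ((k₀ : ℝ) / ((k₀ : ℝ) + 1))) ≤
      4 * n ^ (2 - 2 * σ) + T ^ ((k : ℝ) / ((k : ℝ) + 1)) * n ^ ((4 - 6 * σ) * ((k : ℝ) / ((k : ℝ) + 1))) := by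
  have hn0 : 0 < n := by linarith
  set a : ℝ := T * n ^ (4 - 6 * σ) with ha
  have ha0 : 0 < a := by positivity
  have hterm : ∀ x : ℝ, T ^ x * n ^ ((4 - 6 * σ) * x) = a ^ x := fun x ↦ by
    rw [ha, Real.mul_rpow hT.le (by positivity), Real.rpow_mul hn0.le]
  rw [hterm, hterm]
  have hx : (k₀ : ℝ) / ((k₀ : ℝ) + 1) ≤ (k : ℝ) / ((k : ℝ) + 1) := by
    have hkr : (k₀ : ℝ) ≤ k := by exact_mod_cast hk
    rw [div_le_div_iff₀ (by positivity) (by positivity)]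
    nlinarith
  have hx0 : 0 ≤ (k₀ : ℝ) / ((k₀ : ℝ) + 1) := by positivity
  have h4 : 1 ≤ 4 * n ^ (2 - 2 * σ) := by
    -- `n^{2−2σ} = (n^{σ−1})^{−2} ≥ 1/4`
    have e : n ^ (2 - 2 * σ) = (n ^ (σ - 1)) ^ (-(2 : ℝ)) := by
      rw [← Real.rpow_mul hn0.le]; ring_nf
    rw [e, Real.rpow_neg (by positivity), ← div_eq_mul_inv, le_div_iff₀ (by positivity)]
    have h2 : (n ^ (σ - 1)) ^ (2 : ℝ) ≤ 2 ^ (2 : ℝ) :=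
      Real.rpow_le_rpow (by positivity) hσn (by norm_num)
    norm_num at h2 ⊢
    linarith
  have hk' : 0 ≤ a ^ ((k : ℝ) / ((k : ℝ) + 1)) := by positivity
  rcases le_or_gt 1 a with ha1 | ha1
  · have := Real.rpow_le_rpow_of_exponent_le ha1 hx
    linarith [mul_nonneg (show (0:ℝ) ≤ 4 by norm_num) (Real.rpow_nonneg hn0.le (2 - 2 * σ))]
  · have := Real.rpow_le_one ha0.le ha1.le hx0
    linarith

/-- **`k`-capping, fourth term**: for `k₀ ≤ k`, `1 ≤ N ≤ T`, `N^{σ−1} ≤ 2` and `5/(4k₀+3) ≤ η ≤ 1`,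
`N^{(5−6σ)4k₀/(4k₀+3)}T^{2/(4k₀+3)} ≤ 2^{18} T^η · N^{(5−6σ)4k/(4k+3)}T^{2/(4k+3)}` (with
`c = T²N^{18σ−15} ≤ 2^{18}T⁵` the term is `N^{5−6σ}c^{1/(4k+3)}`: increasing in `k` if `c ≤ 1`, and
otherwise decreasing by at most the factor `c^{1/(4k₀+3)} ≤ 2^{18}T^η`); private plumbing. [folklore] -/
private lemma term4_cap {n T σ η : ℝ} {k k₀ : ℕ} (hn : 1 ≤ n) (hnT : n ≤ T) (hk : k₀ ≤ k)
    (hσn : n ^ (σ - 1) ≤ 2) (hη : 5 / (4 * (k₀ : ℝ) + 3) ≤ η) (hη1 : η ≤ 1) :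
    n ^ ((5 - 6 * σ) * (4 * (k₀ : ℝ) / (4 * (k₀ : ℝ) + 3))) * T ^ (2 / (4 * (k₀ : ℝ) + 3)) ≤
      262144 * T ^ η *
        (n ^ ((5 - 6 * σ) * (4 * (k : ℝ) / (4 * (k : ℝ) + 3))) * T ^ (2 / (4 * (k : ℝ) + 3))) := by
  have hn0 : 0 < n := by linarith
  have hT1 : 1 ≤ T := hn.trans hnT
  have hT0 : 0 < T := by linarith
  have hkr : (k₀ : ℝ) ≤ k := by exact_mod_cast hk
  have hk0 : (0 : ℝ) ≤ k₀ := Nat.cast_nonneg _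
  -- `c = T² N^{18σ−15}` and the representation `term(k) = N^{5−6σ} c^{1/(4k+3)}`
  set c : ℝ := T ^ (2 : ℝ) * n ^ (18 * σ - 15) with hc
  have hc0 : 0 < c := by positivity
  have hrep : ∀ m : ℝ, 0 ≤ m →
      n ^ ((5 - 6 * σ) * (4 * m / (4 * m + 3))) * T ^ (2 / (4 * m + 3)) =
        n ^ (5 - 6 * σ) * c ^ (1 / (4 * m + 3)) := by
    intro m hm
    have h43 : (4 * m + 3) ≠ 0 := by positivity
    rw [hc, Real.mul_rpow (by positivity) (by positivity), ← Real.rpow_mul hT0.le,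
      ← Real.rpow_mul hn0.le]
    have e1 : n ^ ((5 - 6 * σ) * (4 * m / (4 * m + 3))) =
        n ^ (5 - 6 * σ) * n ^ ((18 * σ - 15) * (1 / (4 * m + 3))) := by
      rw [← Real.rpow_add hn0]
      congr 1
      field_simp
      ring
    have e2 : (2 : ℝ) * (1 / (4 * m + 3)) = 2 / (4 * m + 3) := by field_simp
    rw [e1, e2]; ring
  rw [hrep k₀ hk0, hrep k (hk0.trans hkr)]
  set y₀ : ℝ := 1 / (4 * (k₀ : ℝ) + 3) with hy₀
  set y : ℝ := 1 / (4 * (k : ℝ) + 3) with hy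
  have hy0 : 0 < y := by positivity
  have hyy : y ≤ y₀ := by
    rw [hy, hy₀]; exact one_div_le_one_div_of_le (by positivity) (by linarith)
  have hy₀1 : y₀ ≤ 1 := by rw [hy₀, div_le_one (by positivity)]; linarith
  have hη0 : 0 ≤ η := le_trans (by positivity) hη
  have h5y₀ : 5 * y₀ ≤ η := by
    have e : 5 * y₀ = 5 / (4 * (k₀ : ℝ) + 3) := by rw [hy₀]; ring
    rw [e]; exact hη
  have hTη1 : 1 ≤ T ^ η := Real.one_le_rpow hT1 hη0
  have hd0 : 0 ≤ n ^ (5 - 6 * σ) := by positivity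
  have hcy0 : 0 ≤ c ^ y := by positivity
  -- `c ≤ 2^{18} T^5`, so `c^{y₀} ≤ 2^{18} T^η`
  have hcle : c ≤ 2 ^ (18 : ℝ) * T ^ (5 : ℝ) := by
    have e : n ^ (18 * σ - 15) = (n ^ (σ - 1)) ^ (18 : ℝ) * n ^ (3 : ℝ) := by
      rw [← Real.rpow_mul hn0.le, ← Real.rpow_add hn0]; ring_nf
    have h1 : (n ^ (σ - 1)) ^ (18 : ℝ) ≤ 2 ^ (18 : ℝ) :=
      Real.rpow_le_rpow (by positivity) hσn (by norm_num)
    have h2 : n ^ (3 : ℝ) ≤ T ^ (3 : ℝ) := Real.rpow_le_rpow hn0.le hnT (by norm_num)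
    have e5 : T ^ (5 : ℝ) = T ^ (2 : ℝ) * T ^ (3 : ℝ) := by rw [← Real.rpow_add hT0]; norm_num
    rw [hc, e, e5]
    have hT2 : 0 ≤ T ^ (2 : ℝ) := by positivity
    calc T ^ (2 : ℝ) * ((n ^ (σ - 1)) ^ (18 : ℝ) * n ^ (3 : ℝ))
        ≤ T ^ (2 : ℝ) * (2 ^ (18 : ℝ) * T ^ (3 : ℝ)) := by
          refine mul_le_mul_of_nonneg_left ?_ hT2
          exact mul_le_mul h1 h2 (by positivity) (by positivity)
      _ = 2 ^ (18 : ℝ) * (T ^ (2 : ℝ) * T ^ (3 : ℝ)) := by ring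
  have hcy₀ : c ^ y₀ ≤ 262144 * T ^ η := by
    calc c ^ y₀ ≤ (2 ^ (18 : ℝ) * T ^ (5 : ℝ)) ^ y₀ := Real.rpow_le_rpow hc0.le hcle (by positivity)
      _ = (2 ^ (18 : ℝ)) ^ y₀ * (T ^ (5 : ℝ)) ^ y₀ := Real.mul_rpow (by positivity) (by positivity)
      _ ≤ 2 ^ (18 : ℝ) * T ^ η := by
          refine mul_le_mul ?_ ?_ (by positivity) (by positivity)
          · rw [← Real.rpow_mul (by norm_num)]
            calc (2 : ℝ) ^ ((18 : ℝ) * y₀) ≤ (2 : ℝ) ^ (18 : ℝ) :=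
                  Real.rpow_le_rpow_of_exponent_le (by norm_num) (by nlinarith)
              _ = 2 ^ (18 : ℝ) := rfl
          · rw [← Real.rpow_mul hT0.le]
            exact Real.rpow_le_rpow_of_exponent_le hT1 (by linarith)
      _ = 262144 * T ^ η := by norm_num
  rcases le_or_gt c 1 with hc1 | hc1
  · -- `c ≤ 1`: `c^{y₀} ≤ c^{y}`
    have h1 : c ^ y₀ ≤ c ^ y := Real.rpow_le_rpow_of_exponent_ge hc0 hc1 hyy
    calc n ^ (5 - 6 * σ) * c ^ y₀ ≤ n ^ (5 - 6 * σ) * c ^ y := mul_le_mul_of_nonneg_left h1 hd0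
      _ = 1 * 1 * (n ^ (5 - 6 * σ) * c ^ y) := by ring
      _ ≤ 262144 * T ^ η * (n ^ (5 - 6 * σ) * c ^ y) := by gcongr; norm_num
  · -- `c > 1`: `c^{y₀} = c^{y₀ − y} c^{y} ≤ c^{y₀} c^{y}`
    have h1 : c ^ y₀ ≤ c ^ y₀ * c ^ y := by
      have : 1 ≤ c ^ y := Real.one_le_rpow hc1.le hy0.le
      nlinarith [Real.rpow_nonneg hc0.le y₀]
    calc n ^ (5 - 6 * σ) * c ^ y₀ ≤ n ^ (5 - 6 * σ) * (c ^ y₀ * c ^ y) :=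
          mul_le_mul_of_nonneg_left h1 hd0
      _ = c ^ y₀ * (n ^ (5 - 6 * σ) * c ^ y) := by ring
      _ ≤ 262144 * T ^ η * (n ^ (5 - 6 * σ) * c ^ y) :=
          mul_le_mul_of_nonneg_right hcy₀ (by positivity)

set_option maxHeartbeats 1600000 in
/-- **The first display of Proposition 12.1 with the constant uniform in `k`** (the `inf_k` form
`GuthMaynard2026_proposition_12_1_inf_on (7/10)`), from the fixed-`k` bounds (hypothesis `hall`, the
conclusion of `inf_bound_fixed_k` for every `k ≥ 1`, constants depending on `k`). For `k ≤ k₀(ε)`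
(`k₀ = ⌈4/ε⌉ + 1`) the finitely many constants are summed; for `k > k₀` the bound for `k₀` with `T^{ε/2}`
implies the bound for `k` with `T^ε` (`term3_cap`, `term4_cap`: if `W ≠ ∅` then `N^σ ≤ N + 1`, so
`N^{σ−1} ≤ 2`). This bookkeeping is not in the paper, which states the bound with `inf_k` and
`⪅` (constants allowed to depend on the fixed parameters); it is what makes the typed statement, whose
constant depends on `ε` only, follow. [cite: GuthMaynard2026, Proposition 12.1 (first display)] -/
theorem inf_on_of_forall_k
    (hall : ∀ k : ℕ, 1 ≤ k → ∀ ε : ℝ, 0 < ε → ∃ C T₀ : ℝ, 0 ≤ C ∧ ∀ T : ℝ, T₀ ≤ T →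
      ∀ (N : ℕ) (σ : ℝ) (b : ℕ → ℂ) (W : Finset ℝ), T ^ (5 / 6 : ℝ) ≤ (N : ℝ) → (N : ℝ) ≤ T →
      7 / 10 ≤ σ → (∀ n, ‖b n‖ ≤ 1) → (∀ t ∈ W, 0 ≤ t ∧ t ≤ T) →
      (∀ t ∈ W, ∀ t' ∈ W, t ≠ t' → 1 ≤ |t - t'|) →
      (∀ t ∈ W, (N : ℝ) ^ σ ≤ ‖∑ n ∈ Finset.Icc N (2 * N), b n * (n : ℂ) ^ ((t : ℂ) * I)‖) →
      (W.card : ℝ) ≤ C * T ^ ε *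
        ((N : ℝ) ^ (2 - 2 * σ) + T ^ (1 / 2 : ℝ) * (N : ℝ) ^ (3 - 4 * σ) +
          (T ^ ((k : ℝ) / (k + 1)) * (N : ℝ) ^ ((4 - 6 * σ) * (k / (k + 1 : ℝ))) +
            (N : ℝ) ^ ((5 - 6 * σ) * (4 * k / (4 * k + 3 : ℝ))) * T ^ (2 / (4 * k + 3 : ℝ))))) :
    GuthMaynard2026_proposition_12_1_inf_on (7 / 10) := by
  intro ε hε
  classical
  set η : ℝ := min ε 1 / 2 with hη
  have hη0 : 0 < η := by have := lt_min hε one_pos; rw [hη]; linarith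
  have hη1 : η ≤ 1 := by have := min_le_right ε 1; rw [hη]; linarith
  have hηε : 2 * η ≤ ε := by have := min_le_left ε 1; rw [hη]; linarith
  set k₀ : ℕ := ⌈2 / η⌉₊ + 1 with hk₀
  have hk₀1 : 1 ≤ k₀ := by omega
  have hk₀η : 5 / (4 * (k₀ : ℝ) + 3) ≤ η := by
    have h1 : 2 / η ≤ ⌈2 / η⌉₊ := Nat.le_ceil _
    have h2 : (k₀ : ℝ) = ⌈2 / η⌉₊ + 1 := by rw [hk₀]; push_cast; ring
    rw [div_le_iff₀ (by positivity)]
    have h3 : 2 ≤ η * ⌈2 / η⌉₊ := by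
      have := mul_le_mul_of_nonneg_left h1 hη0.le
      rwa [mul_div_cancel₀ _ hη0.ne'] at this
    rw [h2]; nlinarith
  -- the constants for `k ≤ k₀`
  have hKf : ∀ k : ℕ, ∃ C T₀ : ℝ, 0 ≤ C ∧ 0 ≤ T₀ ∧ (1 ≤ k → ∀ T : ℝ, T₀ ≤ T →
      ∀ (N : ℕ) (σ : ℝ) (b : ℕ → ℂ) (W : Finset ℝ), T ^ (5 / 6 : ℝ) ≤ (N : ℝ) → (N : ℝ) ≤ T →
      7 / 10 ≤ σ → (∀ n, ‖b n‖ ≤ 1) → (∀ t ∈ W, 0 ≤ t ∧ t ≤ T) →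
      (∀ t ∈ W, ∀ t' ∈ W, t ≠ t' → 1 ≤ |t - t'|) →
      (∀ t ∈ W, (N : ℝ) ^ σ ≤ ‖∑ n ∈ Finset.Icc N (2 * N), b n * (n : ℂ) ^ ((t : ℂ) * I)‖) →
      (W.card : ℝ) ≤ C * T ^ ε *
        ((N : ℝ) ^ (2 - 2 * σ) + T ^ (1 / 2 : ℝ) * (N : ℝ) ^ (3 - 4 * σ) +
          (T ^ ((k : ℝ) / (k + 1)) * (N : ℝ) ^ ((4 - 6 * σ) * (k / (k + 1 : ℝ))) +
            (N : ℝ) ^ ((5 - 6 * σ) * (4 * k / (4 * k + 3 : ℝ))) * T ^ (2 / (4 * k + 3 : ℝ))))) := by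
    intro k
    by_cases hk : 1 ≤ k
    · obtain ⟨C, T₀, hC0, h⟩ := hall k hk ε hε
      exact ⟨C, max T₀ 0, hC0, le_max_right _ _, fun _ T hT ↦ h T ((le_max_left _ _).trans hT)⟩
    · exact ⟨0, 0, le_rfl, le_rfl, fun h ↦ absurd h hk⟩
  choose Cf Tf hCf0 hTf0 hbd using hKf
  set C_sum : ℝ := ∑ j ∈ Finset.range (k₀ + 1), Cf j with hCsum
  set T_sum : ℝ := ∑ j ∈ Finset.range (k₀ + 1), Tf j with hTsum
  have hCsum0 : 0 ≤ C_sum := Finset.sum_nonneg fun j _ ↦ hCf0 j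
  have hTsum0 : 0 ≤ T_sum := Finset.sum_nonneg fun j _ ↦ hTf0 j
  have hCfle : ∀ j, j ≤ k₀ → Cf j ≤ C_sum := fun j hj ↦
    Finset.single_le_sum (fun i _ ↦ hCf0 i) (Finset.mem_range.2 (by omega))
  have hTfle : ∀ j, j ≤ k₀ → Tf j ≤ T_sum := fun j hj ↦
    Finset.single_le_sum (fun i _ ↦ hTf0 i) (Finset.mem_range.2 (by omega))
  -- the constant for `k > k₀`
  obtain ⟨C_s, T_s, hCs0, hs⟩ := hall k₀ hk₀1 η hη0
  refine ⟨C_sum + 5 * 262144 * C_s, max (max T_sum T_s) 1,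
    fun T hT k N σ b W hk hN56 hNT hσ hb hW hsep hlarge ↦ ?_⟩
  have hTs : T_s ≤ T := le_trans ((le_max_right _ _).trans (le_max_left _ _)) hT
  have hTsum_le : T_sum ≤ T := le_trans ((le_max_left _ _).trans (le_max_left _ _)) hT
  have hT1 : (1 : ℝ) ≤ T := le_trans (le_max_right _ _) hT
  have hT0 : 0 < T := by linarith
  have hN1r : (1 : ℝ) ≤ N := (Real.one_le_rpow hT1 (by norm_num)).trans hN56
  have hN1 : 1 ≤ N := by exact_mod_cast hN1r
  have hN0 : (0 : ℝ) < N := by linarith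
  set n : ℝ := (N : ℝ) with hn
  have hTε0 : 0 ≤ T ^ ε := by positivity
  -- the four terms at `k`
  have ht1 : 0 ≤ n ^ (2 - 2 * σ) := by positivity
  have ht6 : 0 ≤ T ^ (1 / 2 : ℝ) * n ^ (3 - 4 * σ) := by positivity
  have ht3 : 0 ≤ T ^ ((k : ℝ) / (k + 1)) * n ^ ((4 - 6 * σ) * (k / (k + 1 : ℝ))) := by positivity
  have ht4 : 0 ≤ n ^ ((5 - 6 * σ) * (4 * k / (4 * k + 3 : ℝ))) * T ^ (2 / (4 * k + 3 : ℝ)) := by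
    positivity
  have hR0 : 0 ≤ n ^ (2 - 2 * σ) + T ^ (1 / 2 : ℝ) * n ^ (3 - 4 * σ) +
      (T ^ ((k : ℝ) / (k + 1)) * n ^ ((4 - 6 * σ) * (k / (k + 1 : ℝ))) +
        n ^ ((5 - 6 * σ) * (4 * k / (4 * k + 3 : ℝ))) * T ^ (2 / (4 * k + 3 : ℝ))) := by positivity
  by_cases hkk : k ≤ k₀
  · -- finitely many `k`: the summed constant
    have h := hbd k hk T ((hTfle k hkk).trans hTsum_le) N σ b W hN56 hNT hσ hb hW hsep hlarge
    refine h.trans ?_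
    refine mul_le_mul_of_nonneg_right (mul_le_mul_of_nonneg_right ?_ hTε0) hR0
    linarith [hCfle k hkk, mul_nonneg (show (0:ℝ) ≤ 5 * 262144 by norm_num) hCs0]
  · -- `k > k₀`: compare with `k₀`
    push Not at hkk
    have hk₀k : k₀ ≤ k := hkk.le
    rcases Finset.eq_empty_or_nonempty W with hW0 | ⟨t, ht⟩
    · rw [hW0, Finset.card_empty, Nat.cast_zero]; positivity
    -- `W ≠ ∅` gives `N^σ ≤ N + 1`, so `N^{σ−1} ≤ 2`
    have hσn : n ^ (σ - 1) ≤ 2 :=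
      rpow_sub_one_le_two hN1r ((hlarge t ht).trans (norm_dirpoly_Icc_le hN1 hb t))
    have hmain := hs T hTs N σ b W hN56 hNT hσ hb hW hsep hlarge
    have hc3 := term3_cap (T := T) (σ := σ) hN1r hT0 hk₀k hσn
    have hc4 := term4_cap (σ := σ) hN1r hNT hk₀k hσn hk₀η hη1
    have hTη1 : 1 ≤ T ^ η := Real.one_le_rpow hT1 hη0.le
    have hTη0 : 0 ≤ T ^ η := by positivity
    -- the four terms at `k₀` are at most `5 · 2^{18} T^η` times those at `k`
    have hcomp : n ^ (2 - 2 * σ) + T ^ (1 / 2 : ℝ) * n ^ (3 - 4 * σ) +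
        (T ^ ((k₀ : ℝ) / (k₀ + 1)) * n ^ ((4 - 6 * σ) * (k₀ / (k₀ + 1 : ℝ))) +
          n ^ ((5 - 6 * σ) * (4 * k₀ / (4 * k₀ + 3 : ℝ))) * T ^ (2 / (4 * k₀ + 3 : ℝ))) ≤
        5 * 262144 * T ^ η * (n ^ (2 - 2 * σ) + T ^ (1 / 2 : ℝ) * n ^ (3 - 4 * σ) +
        (T ^ ((k : ℝ) / (k + 1)) * n ^ ((4 - 6 * σ) * (k / (k + 1 : ℝ))) +
          n ^ ((5 - 6 * σ) * (4 * k / (4 * k + 3 : ℝ))) * T ^ (2 / (4 * k + 3 : ℝ)))) := by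
      nlinarith [hc3, hc4, hTη1, ht1, ht6, ht3, ht4, mul_nonneg hTη0 ht1, mul_nonneg hTη0 ht6,
        mul_nonneg hTη0 ht3, mul_nonneg hTη0 ht4]
    have hTT : T ^ η * T ^ η ≤ T ^ ε := by
      rw [← Real.rpow_add hT0]
      exact Real.rpow_le_rpow_of_exponent_le hT1 (by linarith)
    calc (W.card : ℝ) ≤ _ := hmain
      _ ≤ C_s * T ^ η * (5 * 262144 * T ^ η * (n ^ (2 - 2 * σ) + T ^ (1 / 2 : ℝ) * n ^ (3 - 4 * σ) +
          (T ^ ((k : ℝ) / (k + 1)) * n ^ ((4 - 6 * σ) * (k / (k + 1 : ℝ))) +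
            n ^ ((5 - 6 * σ) * (4 * k / (4 * k + 3 : ℝ))) * T ^ (2 / (4 * k + 3 : ℝ))))) :=
          mul_le_mul_of_nonneg_left hcomp (by positivity)
      _ = 5 * 262144 * C_s * (T ^ η * T ^ η) * (n ^ (2 - 2 * σ) + T ^ (1 / 2 : ℝ) * n ^ (3 - 4 * σ) +
          (T ^ ((k : ℝ) / (k + 1)) * n ^ ((4 - 6 * σ) * (k / (k + 1 : ℝ))) +
            n ^ ((5 - 6 * σ) * (4 * k / (4 * k + 3 : ℝ))) * T ^ (2 / (4 * k + 3 : ℝ)))) := by ring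
      _ ≤ (C_sum + 5 * 262144 * C_s) * T ^ ε * (n ^ (2 - 2 * σ) + T ^ (1 / 2 : ℝ) * n ^ (3 - 4 * σ) +
          (T ^ ((k : ℝ) / (k + 1)) * n ^ ((4 - 6 * σ) * (k / (k + 1 : ℝ))) +
            n ^ ((5 - 6 * σ) * (4 * k / (4 * k + 3 : ℝ))) * T ^ (2 / (4 * k + 3 : ℝ)))) := by
          refine mul_le_mul_of_nonneg_right ?_ hR0
          refine mul_le_mul (by linarith) hTT (by positivity) (by positivity)

end GuthMaynardFullBound

/-! ## Proposition 12.1 assembled -/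

open GuthMaynardFullBound in
/-- **Guth–Maynard Proposition 12.1, first display, for `σ ≥ 7/10` — from Propositions 6.1 and 10.1
as printed (the tree's `GuthMaynard2026_proposition_6_1`, `GuthMaynard2026_proposition_10_1`, both
proved) and the statement of Proposition 11.1 (`h111`, = `GuthMaynard2026_proposition_11_1`, proved in
`GuthMaynardEnergyBoundAsPrinted.lean`).** "Suppose `(b_n)_{n∼N}`, `(t_r)_{r≤R}` are as in Theorem 1.1,
and that `T^{5/6} ≤ N ≤ T` and `V = N^σ` with `σ ≥ 7/10`. Then
`R ⪅ N^{2−2σ} + T^{1/2}N^{3−4σ} + inf_{k∈ℕ}(T^{k/(k+1)}N^{(4−6σ)k/(k+1)} + N^{(5−6σ)4k/(4k+3)}T^{2/(4k+3)})`."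
Proof as printed, for ALL `σ ≥ 7/10` from (12.1) and (1.1) (the paper invokes Jutila's estimate for
`σ ≥ 39/50`, which is only needed for the second display): the cutoff `w` of §3
(`GuthMaynardAssembly.exists_weight`), (12.1) in the key-proposition setting
(`fullBound_keyProp_setting`), the reduction of §3 (`largeValues_of_fullBound`), the little algebra
(`inf_bound_fixed_k`) and the uniformity in `k` (`inf_on_of_forall_k`).
[cite: GuthMaynard2026, Proposition 12.1 (first display) and its proof, Section 12] -/
theorem GuthMaynard2026_proposition_12_1_inf_of_props
    (h61 : GuthMaynard2026_proposition_6_1) (h101 : GuthMaynard2026_proposition_10_1)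
    (h111 : ∀ ε : ℝ, 0 < ε → ∃ C T₀ : ℝ, ∀ T : ℝ, T₀ ≤ T → ∀ N : ℕ, T ^ (3 / 4 : ℝ) ≤ (N : ℝ) →
      (N : ℝ) ≤ T → ∀ (σ : ℝ) (b : ℕ → ℂ) (t₀ : ℝ) (W : Finset ℝ), (∀ n, ‖b n‖ ≤ 1) →
      (∀ t ∈ W, t₀ ≤ t ∧ t ≤ t₀ + T) → (∀ t ∈ W, ∀ t' ∈ W, t ≠ t' → 1 ≤ |t - t'|) →
      (∀ t ∈ W, (N : ℝ) ^ σ ≤ ‖∑ n ∈ Finset.Ioc N (2 * N), b n * (n : ℂ) ^ ((t : ℂ) * I)‖) →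
      GuthMaynardAssembly.addEnergy W ≤ C * T ^ ε * ((W.card : ℝ) * (N : ℝ) ^ (4 - 4 * σ) +
        (W.card : ℝ) ^ (21 / 8 : ℝ) * T ^ (1 / 4 : ℝ) * (N : ℝ) ^ (1 - 2 * σ) +
        (W.card : ℝ) ^ 3 * (N : ℝ) ^ (1 - 2 * σ))) :
    GuthMaynard2026_proposition_12_1_inf_on (7 / 10) := by
  obtain ⟨w, hw, hsupp, hw1, hw01⟩ := GuthMaynardAssembly.exists_weight
  exact inf_on_of_forall_k fun k hk ↦ inf_bound_fixed_k
    (largeValues_of_fullBound hw1 (fullBound_keyProp_setting hw hsupp hw1 hw01 h61 h101 h111 k hk))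

/-- **Guth–Maynard Proposition 12.1 (both displays) from Propositions 6.1, 10.1, 11.1 and Jutila's
large values theorem** (`Jutila1977_largeValues`, the proved interface of the named fact
`Jutila1977_theorem_1_4`; used only for the second display, via
`GuthMaynard2026_proposition_12_1_of_inf_of_jutila`). [cite: GuthMaynard2026, Proposition 12.1] -/
theorem GuthMaynard2026_proposition_12_1_of_props_of_jutila
    (h61 : GuthMaynard2026_proposition_6_1) (h101 : GuthMaynard2026_proposition_10_1)
    (h111 : ∀ ε : ℝ, 0 < ε → ∃ C T₀ : ℝ, ∀ T : ℝ, T₀ ≤ T → ∀ N : ℕ, T ^ (3 / 4 : ℝ) ≤ (N : ℝ) →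
      (N : ℝ) ≤ T → ∀ (σ : ℝ) (b : ℕ → ℂ) (t₀ : ℝ) (W : Finset ℝ), (∀ n, ‖b n‖ ≤ 1) →
      (∀ t ∈ W, t₀ ≤ t ∧ t ≤ t₀ + T) → (∀ t ∈ W, ∀ t' ∈ W, t ≠ t' → 1 ≤ |t - t'|) →
      (∀ t ∈ W, (N : ℝ) ^ σ ≤ ‖∑ n ∈ Finset.Ioc N (2 * N), b n * (n : ℂ) ^ ((t : ℂ) * I)‖) →
      GuthMaynardAssembly.addEnergy W ≤ C * T ^ ε * ((W.card : ℝ) * (N : ℝ) ^ (4 - 4 * σ) +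
        (W.card : ℝ) ^ (21 / 8 : ℝ) * T ^ (1 / 4 : ℝ) * (N : ℝ) ^ (1 - 2 * σ) +
        (W.card : ℝ) ^ 3 * (N : ℝ) ^ (1 - 2 * σ)))
    (hJ : Jutila1977_largeValues) : GuthMaynard2026_proposition_12_1 :=
  GuthMaynard2026_proposition_12_1_of_inf_of_jutila
    (GuthMaynard2026_proposition_12_1_inf_of_props h61 h101 h111) hJ

/-- **Guth–Maynard Proposition 12.1, first display (`σ ≥ 7/10`, `T^{5/6} ≤ N ≤ T`), PROVED** —
unconditionally: Propositions 6.1, 10.1, 11.1 are the tree's theorems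
`GuthMaynard2026_proposition_6_1_holds`, `GuthMaynard2026_proposition_10_1_holds`,
`GuthMaynard2026_proposition_11_1_holds`. [cite: GuthMaynard2026, Proposition 12.1 (first display)] -/
theorem GuthMaynard2026_proposition_12_1_inf_holds : GuthMaynard2026_proposition_12_1_inf_on (7 / 10) :=
  GuthMaynard2026_proposition_12_1_inf_of_props GuthMaynard2026_proposition_6_1_holds
    GuthMaynard2026_proposition_10_1_holds GuthMaynard2026_proposition_11_1_holds

/-- **Guth–Maynard Proposition 12.1 from Jutila's large values theorem** (the proved interface
`Jutila1977_largeValues`): both displays. [cite: GuthMaynard2026, Proposition 12.1] -/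
theorem GuthMaynard2026_proposition_12_1_of_jutilaLargeValues (hJ : Jutila1977_largeValues) :
    GuthMaynard2026_proposition_12_1 :=
  GuthMaynard2026_proposition_12_1_of_inf_of_jutila GuthMaynard2026_proposition_12_1_inf_holds hJ

/-- **Guth–Maynard Proposition 12.1 modulo the named fact `Jutila1977_theorem_1_4`** (Jutila 1977,
Theorem, (1.4), as printed — the only remaining external input, used for `σ ≥ 39/50` in the second
display exactly as in the printed proof). [cite: GuthMaynard2026, Proposition 12.1] -/
theorem GuthMaynard2026_proposition_12_1_of_jutila (hJ : Jutila1977_theorem_1_4) :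
    GuthMaynard2026_proposition_12_1 :=
  GuthMaynard2026_proposition_12_1_of_jutilaLargeValues (Jutila1977_largeValues_of_theorem_1_4 hJ)

/-- **Guth–Maynard Proposition 12.1, PROVED (both displays, unconditionally).** The only external
input of the printed proof, Jutila's large values theorem [Jutila 1977, Theorem, (1.4)], is the
tree's theorem `Jutila1977_largeValues_holds` (equivalently `Jutila1977_theorem_1_4_holds`,
`LargeValuesJutilaHolds.lean`); Propositions 6.1, 10.1, 11.1 are
`GuthMaynard2026_proposition_6_1_holds`, `GuthMaynard2026_proposition_10_1_holds`,
`GuthMaynard2026_proposition_11_1_holds`. This discharges the named statement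
`GuthMaynard2026_proposition_12_1`. [cite: GuthMaynard2026, Proposition 12.1] -/
theorem GuthMaynard2026_proposition_12_1_holds : GuthMaynard2026_proposition_12_1 :=
  GuthMaynard2026_proposition_12_1_of_props_of_jutila GuthMaynard2026_proposition_6_1_holds
    GuthMaynard2026_proposition_10_1_holds GuthMaynard2026_proposition_11_1_holds
    Jutila1977_largeValues_holds


end Literature.NumberTheory.LFunctions

end
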